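import Mathlib
import HarnessLib
import Literature.Analysis.FluidPDE.VorticityCalculus
import Summits.NavierStokesRegularity.NavierStokesRegularity.Theses.PoloidalWindowDoor
import Summits.NavierStokesRegularity.NavierStokesRegularity.Theses.LoopPeriodRatchet
import Summits.NavierStokesRegularity.NavierStokesRegularity.Theorems.PoloidalWindowDoorPoloidalWindowRigidityWindow
import Summits.NavierStokesRegularity.NavierStokesRegularity.Theorems.SymmetryModuliCountSymmetricLiouville
import Summits.NavierStokesRegularity.NavierStokesRegularity.Theorems.PoloidalWindowDoorPoloidalWindowRigidityHotLoopsReduction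
import Summits.NavierStokesRegularity.NavierStokesRegularity.Theorems.PoloidalWindowDoorPoloidalWindowRigidityHotHullCompactness
import Summits.NavierStokesRegularity.NavierStokesRegularity.Theorems.PoloidalWindowDoorPoloidalWindowRigidityPoloidalExtremal
import Summits.NavierStokesRegularity.NavierStokesRegularity.Theorems.PoloidalWindowDoorPoloidalWindowRigidityPoloidalExtremalSelfRecurrent
import Summits.NavierStokesRegularity.NavierStokesRegularity.Theorems.PoloidalWindowDoorPoloidalWindowRigiditySymmetryGerms
import Summits.NavierStokesRegularity.NavierStokesRegularity.Theorems.PoloidalWindowDoorPoloidalWindowRigidityVerticalShearGerm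
import Summits.NavierStokesRegularity.NavierStokesRegularity.Theorems.PoloidalWindowDoorLrcModEntireFarThreadReduction
import Summits.NavierStokesRegularity.NavierStokesRegularity.Theorems.PoloidalWindowDoorLrcModEntireThreadDichotomy
import Summits.NavierStokesRegularity.NavierStokesRegularity.Theorems.PoloidalWindowDoorLrcModEntireThreadPins
import Summits.NavierStokesRegularity.NavierStokesRegularity.Theorems.PoloidalWindowDoorLrcModEntireIff
import Summits.NavierStokesRegularity.NavierStokesRegularity.Theorems.PoloidalWindowDoorLrcModEntireUntwistedGerm
import Summits.NavierStokesRegularity.NavierStokesRegularity.Theorems.PoloidalWindowDoorLrcModEntireTwistingTHLocalHypGerm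
import Summits.NavierStokesRegularity.NavierStokesRegularity.Theorems.PoloidalWindowDoorLrcModEntireTwistingTHLocalNonUmbilic
import Summits.NavierStokesRegularity.NavierStokesRegularity.Theorems.PoloidalWindowDoorLrcModEntireTwistingTHLocalGalilean
import Summits.NavierStokesRegularity.NavierStokesRegularity.Theorems.PoloidalWindowDoorLrcModEntireTwistingTHLocalNormalFormRS
import Summits.NavierStokesRegularity.NavierStokesRegularity.Theorems.SymmetricLiouville.Negative.SmallConstantGap
import Summits.NavierStokesRegularity.NavierStokesRegularity.Theorems.SymmetricLiouville.Negative.NonlinearLoadBearing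
import Summits.NavierStokesRegularity.NavierStokesRegularity.Theorems.PoloidalWindowDoorPoloidalWindowRigidityLeastPinAnisotropicGap
import Summits.NavierStokesRegularity.NavierStokesRegularity.Theorems.PoloidalWindowDoorPoloidalWindowRigidityLeastPinNoPinLoss
import Summits.NavierStokesRegularity.NavierStokesRegularity.Theorems.PoloidalWindowDoorPoloidalWindowRigidityEternalCoreParaboloidGap
import Summits.NavierStokesRegularity.NavierStokesRegularity.Theorems.PoloidalWindowDoorPoloidalWindowRigidityEternalCoreScalingCore
import Literature.Analysis.FluidPDE.TypeIAncientMildRescale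
import Literature.Analysis.FluidPDE.NSBoundedMildSmoothing
import Summits.NavierStokesRegularity.NavierStokesRegularity.Theorems.PoloidalWindowDoorPoloidalWindowRigidityHotSplitRidgeKernels

/-!
# Crux `PoloidalWindowRigidity` (K2, stmt-NavierStokesRegularity-19708) + item `LrcModEntire` (stmt-20428) — LINE 26 `eternal_web` (v1.2 = v1.1 + docstring fix; v1.1: hand U4b `VerticalCore` PROVED in-file — sorries 2)
# (IDEATOR seat ns-idea-8, generation 12; lens «barrier» — barrier-inversion of this seat's census B-g11-2 «no exactly pinned blow-down: the aperture Λ(η) is not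
#  uniform» and B-g11-3 «no time-monotonicity of the pin value M(t) is known»; bears_on LADDER-NS N0, rung N0-LocalTubeDoorPoloidal, THICK column; targets the
#  UNIVERSAL residue HL3′ of the column through LINE 25's research cell ETERNAL-PIN, VERBATIM, which it SPLITS into two cells by a proved dichotomy.)

**No summit and no crux is proved here.**  `PoloidalWindowRigidity_of_cells` / `LrcModEntire_of_cells` are CONDITIONAL on the hand U4b, the two sorried research
cells and the two shared column hypotheses S0 and ⟨27893⟩ (explicit binders `hS0`, `hG` — the (TH) column's `stub_localTHEmptyHypNUGRS` and the wall
`LoopPeriodRatchet.FrequencyGrowthExponent`), like every line of the column.  §0–§14 are LINE 25 `eternal_pin` v1.0 VERBATIM (every def identical; U3a p709185,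
U3b p709332, U2b p707892 wired by name; LINE 25's `stub_cellEternalPin` is REMOVED — `CellEternalPin` is DERIVED here, §20), re-namespaced; the NEW content is
§15–§21.  Sorries = 2 (v1.1): `stub_cellEternalWeb`, `stub_cellBreathing` (research cells); the hand U4b `VerticalCore` is PROVED (`verticalCore_holds`, §18;
`stub_verticalCore` kept as a sorry-free alias).

## Thesis (one sentence)

The least-pin critical element `v` of the THICK column (LINE 24/25: pinned, thick mod S0, peakless, least pin `|N|`, no pin loss, past pin, pinned in every scale
window with aperture `Λ(η)`) has a one-variable shadow, the PARABOLOID PIN VALUE `M_A(t) := sup{√(−t)|v₂(t,x)| : ‖x‖ ≤ A√(−t)} ≤ |N|`, and EXACTLY ONE of two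
things happens (`dichotomy`, logic): (E) `M_A(t) → |N|` as `t → −∞` for some aperture `A` (`AsymptoticallyPinned A v`) — then (`eternalWebExtraction`, PROVED)
the blow-down hull of `v` contains a pinned peakless profile `W` with the SAME pin value which is ETERNALLY PINNED (`EternallyPinned (2A) C W`: at EVERY `t ≤ −1`
the full pin `|N|` is realised at a point `‖x(t)‖ ≤ 2A√(−t)`, and the blow-down at scale `√(−t)` re-centred there is again a `Pinned C` column profile — all
nine conjuncts, `pinned_recentre` — so that, `Peakless` being scale/translation invariant, the hot point lies on an UNBOUNDED planar hot web at every time,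
`eternalWeb_unbounded`, by K2-p3's `hotSpot_component_unbounded`); or (B) `Breathing v`: for EVERY aperture `A` there is a defect `η(A) > 0` such that
`√(−t)|v₂(t,·)| ≤ |N| − η(A)` on the whole ball `‖x‖ ≤ A√(−t)` at arbitrarily ancient times `t` — while LINE 25 forces returns above `|N| − η′` within aperture
`Λ(η′)` in every scale window and the VERTICAL CORE (hand U4b + U2b) a floor `M_R ≥ δ > 0` in every scale window (`verticalEternalCore_of_pinned`).

## Why this line (lens «barrier»: type BOTH sides of the missing monotonicity)

LINE 25 left the pin ETERNAL IN SCALE only up to a defect `η` with aperture `Λ(η)`; census B-g11-2 says `Λ(η)` need not stay bounded as `η → 0` (so no exactly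
pinned blow-down), B-g11-3 that no monotonicity of `t ↦ M(t)` is known (a theorem «`M(t) → |N|`» would be new input U4).  The barrier-inversion is to make
«`M_A(t) → |N|`» a CASE rather than a theorem.  On the branch where it holds, the defect disappears EXACTLY: blow-downs converge UNIFORMLY on each compact ball
`‖y‖ ≤ A√(−t)` (Mathlib `tendstoLocallyUniformlyOn_iff_tendstoUniformlyOn_of_compact`), the asymptotic near-pins of `v` at the physical times `(n+1)²t → −∞` pull
back into that ball, and the maximum of `√(−t)|V₂(t,·)|` over the ball — attained by compactness — is `≥ |N| − 2η` for every `η`, hence `= |N|`, at EVERY `t < 0`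
(B-g11-2 inverted by a theorem on this branch).  Re-centring (`nsRescale_one`, `isTypeIAncientMild_translate`) puts the time-`(−1)` hot point at the origin; the
profile keeps the pin value `|N|`, so LINE 24's `LeastPin` transfers for free and U3b / `pastPin` / `scaleWindowPin_of_noPinLoss` / `thickWindow_of_dense` re-furnish
it (kernel `cellEternalPin_of_cells`).  On the other branch the failure of saturation is a located, quantified oscillation (BREATHING) with a proved floor.  The
two cells are the exact homes of the column's two natural enemies: an exactly-pinned e₂-poloidal DSS / self-similar profile (ETERNAL-WEB; the self-similar corner
is dead by the tree's `…RotDriftLiouville`) and a generic, log-periodically breathing DSS profile (BREATHING) — the DSS wall of the column is SPLIT along «pinned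
at all times or not», and the first half now carries exact all-times structure (pins, pressure push `σ∂₂p ≤ −|N|/(2(−t)^{3/2})`, unbounded hot web) for the
(TH) ridge machinery of K2-p3 (one-time statements p704227…p711840; their question (M2), T2B-g14 §14b) to act on.

## What is proved / what is open

PROVED (no sorry): everything of LINE 25 v1.0 + `abs_apply_two_le_norm`, `abs_apply_two_sub_le_dist`, `dichotomy`, `peakless_recentre`, `pinned_recentre`,
`eternalWebExtraction`, `eternalWeb_unbounded`, `verticalEternalCore_of_pinned` (from U4b), the kernel `cellEternalPin_of_cells` / `cellEternalPin_of_cellsStub`,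
`PoloidalWindowRigidity_of_cells` / `LrcModEntire_of_cells` (+ `…_of_cellStubs`) BY NAME through LINE 25's `PoloidalWindowRigidity_of_eternalPin`.
OPEN (sorries 2, v1.1+): `stub_cellEternalWeb`, `stub_cellBreathing` (research); the hand U4b `stub_verticalCore` is PROVED in-file (`verticalCore_holds`:
compactness + the tree's `eq_zero_of_horizontalGradient_eq_zero_on_open`).  Killing quantity still missing (honest) for both cells; nothing of the kind is claimed.

## Novelty / prior art (search-before-claim)

Nearest in the tree: LINE 25 `nearPinnedBlowDownLimit` (ONE time, defect `η`; delta: EVERY time, defect `0`, by uniform-on-compacts convergence under the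
asymptotic-pinning case hypothesis); K2-p3's (TH)-column hot web T2b and question (M2) (one time / asked; delta: all times, THICK column, derived from a
dichotomy); LINE 23's eternal core (`ε₀`-non-smallness of `|v|`; delta: exact maximality of `|v₂|`).  Literature (corpus fts+vec AND galaxy, HOME
`lines/l26/presearch.txt`): the Merle–Zaag-type «limits at `s → −∞` are stationary / connecting orbits» classification for semilinear heat in similarity
variables ([corpus:giga2010 pp.112–114]; [galaxy:pdf:-2913178032216208180] Fila–Yanagida homoclinic/heteroclinic orbits; [galaxy:pdf:6308102236741178220]
Fermanian-Kammerer–Zaag) is the analogue in spirit — ETERNAL-WEB / BREATHING = «pinned at −∞ / oscillating», with the pin value for the energy; NS Type-I texts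
([corpus:seregin2014 pp.109,130–131], [corpus:lemarie-rieusset2016 pp.576–577,771], [corpus:majda2002 pp.103–104]) carry no paraboloid-pin dichotomy; galaxy
"eternal solution|ancient solution|backward self-similar" / "Merle-Zaag|Liouville theorem for ancient|type I ancient" --star pdf → nothing of this shape for NS.
Delta in one sentence: a case split on the far-past limit of the paraboloid pin value converts LINE 25's `η`-located eternal pin into an EXACT all-times pinned
object on one side and a typed oscillation on the other.

## Barriers

- technique_class: critical element + blow-down compactness with UNIFORM convergence on compact balls + per-time Fermat re-pinning + planar hot-set topology +
  quantitative unique continuation along the poloidal axis (U4b); a dichotomy replaces the missing monotone quantity.  NOT point-local, NOT averaged, NOT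
  finite-jet (Theorem P's empty polynomial sector is not re-found), NOT a comparison principle, NOT leaf-local, no frequency functional.
- B-g11-2: inverted by `eternalWebExtraction` on branch (E); typed as the datum `η(A)` on branch (B).  B-g11-3: evaded (no monotonicity needed).  B-g8-3: as
  LINE 25, exact on branch (E).  B-g10-2: no new extremalisation (same pin value; LINE 24's gap inherited).
- `NearOneDssTypeIExclusion`: the cells sit in its open sector (λ arbitrary, no spatial decay); not beaten — SPLIT.  `AxisymmetricTypeIExclusion` consistent;
  `LeraySelfSimilarBlowupExclusion` / Tsai: the self-similar corner of ETERNAL-WEB, dead by `…RotDriftLiouville`.  `GaussianMonotonicityVertexDivergence`,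
  `HyperbolicSystemNoComparison`, `PressureSlaving`: not engaged.
- Wall ⟨27893⟩ / S0: untouched, entering only through the landed reduction and `THGerm`, as in every line of the column.
- Negatives index (`ledger negatives --problem NavierStokesRegularity`): no refuted statement concerns paraboloid pin values, per-time pins, breathing or the
  vertical core; `stub_smallAtMinusInfinityLiouville` (dead: smallness at −∞) is the opposite regime of both cells.

## Hands and cells (sorries = 2)

* `stub_verticalCore` — hand U4b `VerticalCore`: PROVED in v1.1 (`verticalCore_holds`).
* `stub_cellEternalWeb` — research cell ETERNAL-WEB (OPEN): LINE 25's binders + `0 < A` + `EternallyPinned A C v`.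
* `stub_cellBreathing` — research cell BREATHING (OPEN): `VerticalCore` + LINE 25's binders + `Breathing v`.
* PROVED: as listed.  LABELS: files-only line of a door route; no cell / crux / route item closed; 19708 / 20428 OPEN; NS regularity NOT proved.
-/

noncomputable section

set_option linter.dupNamespace false
set_option linter.unusedVariables false
set_option linter.unusedSectionVars false

namespace Summit.NavierStokesRegularity.NavierStokesRegularity.Cruxes.PoloidalWindowRigidity.EternalWeb

open Set Function MeasureTheory Filter Topology Metric
open scoped InnerProductSpace RealInnerProductSpace Laplacian
open Literature.Analysis Literature.Analysis.FluidPDE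
open Summit.NavierStokesRegularity.NavierStokesRegularity.Theses.PoloidalWindowDoor
open Summit.NavierStokesRegularity.NavierStokesRegularity.Theorems

/-! ## §0 The column's objects, VERBATIM (hot_split v1.6 = hot_forest = hot_hull = uniform_return = eternal_core) -/

/-- **Pinned** — VERBATIM hot_split: Type-I decay, continuity, mild identity, div-free, e₃-poloidal, `N := v₂(−1,0) ≠ 0`, the global bound
`√(−t)|v₂| ≤ |N|`, `∇v₂(−1,0) = 0`, the time and Laplace pins. -/
def Pinned (C : ℝ) (v : ℝ → EuclideanSpace ℝ (Fin 3) → EuclideanSpace ℝ (Fin 3)) : Prop :=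
  Literature.Analysis.FluidPDE.HasTypeITimeDecay C v ∧
  ContinuousOn (Function.uncurry v) (Set.Iio (0 : ℝ) ×ˢ Set.univ) ∧
  (∀ s t : ℝ, s < t → t < 0 → ∀ x, v t x =
    Literature.Analysis.UnboundedOperators.heatExtension (v s) (t - s) x -
      Literature.Analysis.FluidPDE.oseenDuhamel 1 s v v t x) ∧
  (∀ t < 0, Literature.Analysis.FluidPDE.VectorCalculus.IsDivFree (v t)) ∧
  (∀ s < 0, ∀ y, ⟪Literature.Analysis.FluidPDE.curl (v s) y, EuclideanSpace.single 2 1⟫_ℝ = 0) ∧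
  v (-1) 0 2 ≠ 0 ∧ (∀ t < 0, ∀ x, Real.sqrt (-t) * |v t x 2| ≤ |v (-1) 0 2|) ∧
  (∀ h : EuclideanSpace ℝ (Fin 3), fderiv ℝ (v (-1)) 0 h 2 = 0) ∧
  (deriv (fun s => v s 0 2) (-1) = v (-1) 0 2 / 2 ∧ v (-1) 0 2 * (Δ (fun y => v (-1) y 2)) 0 ≤ 0)

/-- **ThickWindow** — VERBATIM hot_split. -/
def ThickWindow (v : ℝ → EuclideanSpace ℝ (Fin 3) → EuclideanSpace ℝ (Fin 3)) (W : Set (ℝ × EuclideanSpace ℝ (Fin 3))) : Prop :=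
  IsOpen W ∧ W ⊆ Set.Iio (0 : ℝ) ×ˢ Set.univ ∧
  (∀ z ∈ W, (Literature.Analysis.FluidPDE.curl (v z.1) z.2 ≠ 0 ∧
      (fderiv ℝ (v z.1) z.2 (EuclideanSpace.single 0 1) 2 ≠ 0 ∨ fderiv ℝ (v z.1) z.2 (EuclideanSpace.single 1 1) 2 ≠ 0) ∧
      (fderiv ℝ (v z.1) z.2 (EuclideanSpace.single 2 1) 0 ≠ 0 ∨ fderiv ℝ (v z.1) z.2 (EuclideanSpace.single 2 1) 1 ≠ 0)) ∧
    (fderiv ℝ (fun x => fderiv ℝ (v z.1) x (EuclideanSpace.single 2 1) 2) z.2 (EuclideanSpace.single 0 1) *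
          fderiv ℝ (v z.1) z.2 (EuclideanSpace.single 1 1) 2 -
        fderiv ℝ (fun x => fderiv ℝ (v z.1) x (EuclideanSpace.single 2 1) 2) z.2 (EuclideanSpace.single 1 1) *
          fderiv ℝ (v z.1) z.2 (EuclideanSpace.single 0 1) 2 ≠ 0)) ∧
  (∀ m : ℝ → ℝ → ℝ, ∀ W₁ : Set (ℝ × EuclideanSpace ℝ (Fin 3)), W₁ ⊆ W → IsOpen W₁ → W₁.Nonempty →
      ∃ z ∈ W₁, ∃ b : Fin 3, b ≠ 2 ∧
        fderiv ℝ (v z.1) z.2 (EuclideanSpace.single 2 1) b ≠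
          m z.1 (z.2 2) * fderiv ℝ (v z.1) z.2 (EuclideanSpace.single b 1) 2) ∧
  (∀ r : ℝ, 0 < r → (Metric.ball ((-1 : ℝ), (0 : EuclideanSpace ℝ (Fin 3))) r ∩ W).Nonempty)

/-- **Peakless** — VERBATIM hot_split: no island bracket of `σ·v₂(s,·)` on any horizontal plane at any time `s < 0`. -/
def Peakless (v : ℝ → EuclideanSpace ℝ (Fin 3) → EuclideanSpace ℝ (Fin 3)) : Prop :=
  ∀ (s z₀ σ M : ℝ) (K O : Set (EuclideanSpace ℝ (Fin 3))), s < 0 →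
    ((σ = 1 ∨ σ = -1) ∧ IsCompact K ∧ K.Nonempty ∧ (∀ y ∈ K, y 2 = z₀ ∧ σ * v s y 2 = M) ∧
      IsOpen O ∧ K ⊆ O ∧ (∀ y ∈ O, y 2 = z₀ → σ * v s y 2 ≤ M) ∧
      (∀ y ∈ O, y 2 = z₀ → σ * v s y 2 = M → y ∈ K)) → False

/-- The HOT SET of the hot-spot plane `P₀ = {y₂ = 0}` at time `−1` — VERBATIM hot_split: `H := {y : y₂ = 0, v₂(−1,y) = v₂(−1,0)}`. -/
def hotSet (v : ℝ → EuclideanSpace ℝ (Fin 3) → EuclideanSpace ℝ (Fin 3)) : Set (EuclideanSpace ℝ (Fin 3)) :=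
  {y | y 2 = 0 ∧ v (-1) y 2 = v (-1) 0 2}

/-- `ThickWindow` re-centred at an arbitrary space-time point `z₀` (the body of `ThickWindow`, VERBATIM, with `Metric.ball z₀ r`);
`ThickWindowAt v W (−1, 0)` is `ThickWindow v W` definitionally. -/
def ThickWindowAt (v : ℝ → EuclideanSpace ℝ (Fin 3) → EuclideanSpace ℝ (Fin 3)) (W : Set (ℝ × EuclideanSpace ℝ (Fin 3)))
    (z₀ : ℝ × EuclideanSpace ℝ (Fin 3)) : Prop :=
  IsOpen W ∧ W ⊆ Set.Iio (0 : ℝ) ×ˢ Set.univ ∧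
    (∀ z ∈ W, (Literature.Analysis.FluidPDE.curl (v z.1) z.2 ≠ 0 ∧
        (fderiv ℝ (v z.1) z.2 (EuclideanSpace.single 0 1) 2 ≠ 0 ∨ fderiv ℝ (v z.1) z.2 (EuclideanSpace.single 1 1) 2 ≠ 0) ∧
        (fderiv ℝ (v z.1) z.2 (EuclideanSpace.single 2 1) 0 ≠ 0 ∨ fderiv ℝ (v z.1) z.2 (EuclideanSpace.single 2 1) 1 ≠ 0)) ∧
      (fderiv ℝ (fun x => fderiv ℝ (v z.1) x (EuclideanSpace.single 2 1) 2) z.2 (EuclideanSpace.single 0 1) *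
            fderiv ℝ (v z.1) z.2 (EuclideanSpace.single 1 1) 2 -
          fderiv ℝ (fun x => fderiv ℝ (v z.1) x (EuclideanSpace.single 2 1) 2) z.2 (EuclideanSpace.single 1 1) *
            fderiv ℝ (v z.1) z.2 (EuclideanSpace.single 0 1) 2 ≠ 0)) ∧
    (∀ m : ℝ → ℝ → ℝ, ∀ W₁ : Set (ℝ × EuclideanSpace ℝ (Fin 3)), W₁ ⊆ W → IsOpen W₁ → W₁.Nonempty →
        ∃ z ∈ W₁, ∃ b : Fin 3, b ≠ 2 ∧
          fderiv ℝ (v z.1) z.2 (EuclideanSpace.single 2 1) b ≠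
            m z.1 (z.2 2) * fderiv ℝ (v z.1) z.2 (EuclideanSpace.single b 1) 2) ∧
    (∀ r : ℝ, 0 < r → (Metric.ball z₀ r ∩ W).Nonempty)


/-! ## §1 Class bookkeeping (PROVED, as in LINE 22 / LINE 23) -/

/-- The class of a pinned profile (tree `isTypeIAncientMild_of_class`). -/
theorem class_of_pinned {C : ℝ} {U : ℝ → EuclideanSpace ℝ (Fin 3) → EuclideanSpace ℝ (Fin 3)} (hP : Pinned C U) : IsTypeIAncientMild C U :=
  PoloidalWindowDoorPoloidalWindowRigidityWindow.isTypeIAncientMild_of_class hP.1 hP.2.1 hP.2.2.1 hP.2.2.2.1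

/-- A pinned profile is not identically zero (`N = U₂(−1,0) ≠ 0`). -/
theorem pinned_absurd_of_zero {C : ℝ} {U : ℝ → EuclideanSpace ℝ (Fin 3) → EuclideanSpace ℝ (Fin 3)} (hP : Pinned C U)
    (hz : ∀ t < 0, ∀ x, U t x = 0) : False := by
  have hN : U (-1) 0 2 ≠ 0 := hP.2.2.2.2.2.1
  have h0 : U (-1) 0 = 0 := hz (-1) (by norm_num) 0
  exact hN (by rw [h0]; rfl)

/-- Components commute with the derivative: `D(y ↦ a(y)ᵢ)(x)h = (Da(x)h)ᵢ` (tree idiom, `…CriticalFluxDoorPressureIBP.fderiv_coord_apply`). -/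
theorem fderiv_coord_apply' {a : EuclideanSpace ℝ (Fin 3) → EuclideanSpace ℝ (Fin 3)} {x : EuclideanSpace ℝ (Fin 3)}
    (ha : DifferentiableAt ℝ a x) (i : Fin 3) (h : EuclideanSpace ℝ (Fin 3)) :
    fderiv ℝ (fun y => a y i) x h = fderiv ℝ a x h i := by
  have hc := ((EuclideanSpace.proj (𝕜 := ℝ) i).hasFDerivAt.comp x ha.hasFDerivAt).fderiv
  rw [show (fun y => a y i) = (EuclideanSpace.proj (𝕜 := ℝ) i) ∘ a from rfl, hc]
  rfl

/-! ## §2 R — VERTICAL RIGIDITY (PROVED BY NAME): the poloidal-axis component alone detects non-triviality -/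

/-- **R (vertical rigidity).**  A class-`C` profile which is e₂-poloidal at some time `s < 0` and whose vertical component vanishes identically at that
time is `≡ 0` on the whole past.  Two lines from the tree's `…SymmetryGerms.eq_zero_of_horizontalGradient_eq_zero_on_open` (which needs only `∂₀v₂ = 0` on
an open set at one poloidal time: `(v₀,v₁)` is then an `L^∞` conjugate-harmonic pair in every horizontal plane). -/
theorem verticalRigidity {C : ℝ} {v : ℝ → EuclideanSpace ℝ (Fin 3) → EuclideanSpace ℝ (Fin 3)}
    (hrate : HasTypeITimeDecay C v) (hcont : ContinuousOn (Function.uncurry v) (Set.Iio (0 : ℝ) ×ˢ Set.univ))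
    (hmild : ∀ s t : ℝ, s < t → t < 0 → ∀ x, v t x = UnboundedOperators.heatExtension (v s) (t - s) x - oseenDuhamel 1 s v v t x)
    (hdiv : ∀ t < 0, VectorCalculus.IsDivFree (v t)) {s : ℝ} (hs : s < 0)
    (hpol : ∀ y, ⟪curl (v s) y, EuclideanSpace.single 2 1⟫_ℝ = 0) (h2 : ∀ y, v s y 2 = 0) :
    ∀ t < 0, ∀ x, v t x = 0 := by
  have hA : AnalyticOnNhd ℝ (v s) Set.univ :=
    (PoloidalWindowDoorPoloidalWindowRigidityWindow.isTypeIAncientMild_of_class hrate hcont hmild hdiv).analyticOnNhd_slice_univ hs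
  refine PoloidalWindowDoorPoloidalWindowRigiditySymmetryGerms.eq_zero_of_horizontalGradient_eq_zero_on_open hrate hcont hmild hdiv hs
    hpol isOpen_univ Set.univ_nonempty fun y _ => ?_
  rw [← fderiv_coord_apply' ((hA y (Set.mem_univ y)).differentiableAt) 2]
  have hz : (fun y => v s y 2) = fun _ => (0 : ℝ) := funext h2
  rw [hz]
  simp

/-- R for pinned-class vocabulary: a class-`C` e₂-poloidal profile that is not `≡ 0` has `v₂(s,·) ≢ 0` at EVERY time `s < 0`. -/
theorem vertical_nonvanishing {C : ℝ} {v : ℝ → EuclideanSpace ℝ (Fin 3) → EuclideanSpace ℝ (Fin 3)}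
    (hrate : HasTypeITimeDecay C v) (hcont : ContinuousOn (Function.uncurry v) (Set.Iio (0 : ℝ) ×ˢ Set.univ))
    (hmild : ∀ s t : ℝ, s < t → t < 0 → ∀ x, v t x = UnboundedOperators.heatExtension (v s) (t - s) x - oseenDuhamel 1 s v v t x)
    (hdiv : ∀ t < 0, VectorCalculus.IsDivFree (v t))
    (hpol : ∀ s < 0, ∀ y, ⟪curl (v s) y, EuclideanSpace.single 2 1⟫_ℝ = 0) (hne : ¬ ∀ t < 0, ∀ x, v t x = 0) :
    ∀ s < 0, ∃ y, v s y 2 ≠ 0 := by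
  intro s hs
  by_contra h
  push Not at h
  exact hne (verticalRigidity hrate hcont hmild hdiv hs (hpol s hs) h)

/-! ## §3 U3a — the ANISOTROPIC GAP (hand, M) and the PIN LOWER BOUND (PROVED from it) -/

/-- **U3a `AnisotropicGap` (PROVABLE, M — hand target).**  For every Type-I constant `C` there is `δ = δ(C) > 0` such that every class-`C` e₂-poloidal profile
with `sup √(−t)|v₂| ≤ δ` is `≡ 0`.  Proof for the hand (template: the tree's `…PoloidalExtremal.exists_poloidal_extremal`, p469616, which runs exactly this
extraction): a violating sequence `vₙ` (`δ = 1/(n+1)`, `vₙ ≢ 0`) has points `(tₙ, xₙ)` with `√(−tₙ)‖vₙ(tₙ,xₙ)‖ > ε₀` by the ISOTROPIC gap (tree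
`SymmetricLiouville.Negative.exists_eps_small_vanishes` with `inClass_iff_isTypeIAncientMild`); the renormalised fields `√(−tₙ)·vₙ(−tₙ s, xₙ + √(−tₙ) y)` are class
`C` (`isTypeIAncientMild_zoomTranslate`), e₂-poloidal (`poloidal_nsRescale`, `poloidal_translate`), have `‖·(−1,0)‖ > ε₀` and `sup √(−s)|(·)₂| ≤ 1/(n+1)`;
a KNSS limit with gradients (`…Theorems.exists_tendsto_of_isTypeIAncientMild_seq`, `poloidal_of_tendsto`) is class `C`, poloidal, has `‖V(−1,0)‖ ≥ ε₀` and
`V₂ ≡ 0` — absurd by `verticalRigidity`. -/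
def AnisotropicGap : Prop :=
  ∀ C : ℝ, ∃ δ : ℝ, 0 < δ ∧ ∀ v : ℝ → EuclideanSpace ℝ (Fin 3) → EuclideanSpace ℝ (Fin 3), IsTypeIAncientMild C v →
    (∀ s < 0, ∀ y, ⟪curl (v s) y, EuclideanSpace.single 2 1⟫_ℝ = 0) →
    (∀ t < 0, ∀ x, Real.sqrt (-t) * |v t x 2| ≤ δ) → ∀ t < 0, ∀ x, v t x = 0

/-- **stub U3a — LANDED (v1.1)**: p709185 ACCEPTED `Theorems/PoloidalWindowDoorPoloidalWindowRigidityLeastPinAnisotropicGap.lean` (ns-es-p1 g8), decl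
`…LeastPinAnisotropicGap.anisotropicGap` = `AnisotropicGap` VERBATIM (critic idea-crit-7 g8 exact-string pin 08:33:15Z); wired BY NAME. -/
theorem stub_anisotropicGap : AnisotropicGap :=
  Summit.NavierStokesRegularity.NavierStokesRegularity.Theorems.PoloidalWindowDoorPoloidalWindowRigidityLeastPinAnisotropicGap.anisotropicGap

/-- **The pin is never shallow (PROVED from U3a):** every pinned class-`C` profile has `|N| = |v₂(−1,0)| ≥ δ(C)`. -/
theorem pin_lower_bound (hAG : AnisotropicGap) (C : ℝ) :
    ∃ δ : ℝ, 0 < δ ∧ ∀ v : ℝ → EuclideanSpace ℝ (Fin 3) → EuclideanSpace ℝ (Fin 3), Pinned C v → δ ≤ |v (-1) 0 2| := by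
  obtain ⟨δ, hδ, hgap⟩ := hAG C
  refine ⟨δ, hδ, fun v hP => ?_⟩
  by_contra hlt
  have hlt' : |v (-1) 0 2| < δ := lt_of_not_ge hlt
  exact pinned_absurd_of_zero hP
    (hgap v (class_of_pinned hP) hP.2.2.2.2.1 (fun t ht x => (hP.2.2.2.2.2.2.1 t ht x).trans hlt'.le))

/-! ## §4 COMPACTNESS of the pinned–peakless class WITH its nondegeneracy (PROVED; the tree's `classCompactness` with the common pin value replaced by a
lower bound) -/

/-- **`PinnedCompact`**: a sequence of pinned peakless class-`C` profiles whose pin values stay `≥ δ > 0` in absolute value has a subsequence converging —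
locally uniformly on every slice, the vorticity slice at `−1` as well — to a PINNED PEAKLESS class-`C` profile. -/
def PinnedCompact : Prop :=
  ∀ (C δ : ℝ) (vs : ℕ → ℝ → EuclideanSpace ℝ (Fin 3) → EuclideanSpace ℝ (Fin 3)), 0 < δ →
    (∀ k, Pinned C (vs k)) → (∀ k, Peakless (vs k)) → (∀ k, δ ≤ |vs k (-1) 0 2|) →
      ∃ (φ : ℕ → ℕ) (U : ℝ → EuclideanSpace ℝ (Fin 3) → EuclideanSpace ℝ (Fin 3)), StrictMono φ ∧ Pinned C U ∧ Peakless U ∧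
        (∀ t < 0, TendstoLocallyUniformly (fun j => vs (φ j) t) (U t) Filter.atTop) ∧
        TendstoLocallyUniformly (fun j => curl (vs (φ j) (-1))) (curl (U (-1))) Filter.atTop

/-- **`PinnedCompact` PROVED** (KNSS extraction with gradients `…Theorems.exists_tendsto_of_isTypeIAncientMild_seq`; poloidality by `poloidal_of_tendsto`; the pin
value of the limit is the limit of the pin values, `≥ δ` hence `≠ 0`; the Type-I extremality passes to the limit; the three pins by Fermat — tree
`threadPin_of_hotSpot`, `threadSignedPin`; `Peakless` by tree `peaklessClosed`; vorticity slices by `curl = curlCLM ∘ D`).  Adapted line by line from the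
tree's `…HotHullCompactness.classCompactness` (K2-p2 g14). -/
theorem pinnedCompact : PinnedCompact := by
  intro C δ vs hδ hP hK hNδ
  have hw : ∀ k, IsTypeIAncientMild C (vs k) := fun k => class_of_pinned (hP k)
  obtain ⟨φ, hφ, W, hW, hpt, hfd, htlu, htlufd⟩ := exists_tendsto_of_isTypeIAncientMild_seq C hw
  have hrate : HasTypeITimeDecay C W := hW.2.2.2
  have hcont : ContinuousOn (Function.uncurry W) (Set.Iio (0 : ℝ) ×ˢ Set.univ) := hW.1.continuousOn
  have hmild : ∀ s t : ℝ, s < t → t < 0 → ∀ x, W t x =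
      UnboundedOperators.heatExtension (W s) (t - s) x - oseenDuhamel 1 s W W t x :=
    fun s t hst ht x => hW.mild_eq_heatExtension hst ht x
  have hdiv : ∀ t < 0, VectorCalculus.IsDivFree (W t) := hW.2.1
  have hpol : ∀ s < 0, ∀ y, ⟪curl (W s) y, EuclideanSpace.single 2 1⟫_ℝ = 0 :=
    fun s hs y => PoloidalWindowDoorPoloidalWindowRigidityPoloidalExtremal.poloidal_of_tendsto (hfd s hs y)
      (fun j => (hP (φ j)).2.2.2.2.1 s hs y)
  have hc2 : Continuous fun x : EuclideanSpace ℝ (Fin 3) => x 2 := by fun_prop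
  have hval : ∀ t < 0, ∀ x, Tendsto (fun j => vs (φ j) t x 2) atTop (𝓝 (W t x 2)) :=
    fun t ht x => (hc2.tendsto _).comp (hpt t ht x)
  -- the pin values converge to the pin value of the limit, which is therefore `≥ δ > 0` in absolute value
  have hNabs : Tendsto (fun j => |vs (φ j) (-1) 0 2|) atTop (𝓝 |W (-1) 0 2|) :=
    (continuous_abs.tendsto _).comp (hval (-1) (by norm_num) 0)
  have hNge : δ ≤ |W (-1) 0 2| := ge_of_tendsto hNabs (Eventually.of_forall fun j => hNδ (φ j))
  have hne : W (-1) 0 2 ≠ 0 := by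
    intro h0
    rw [h0, abs_zero] at hNge
    exact absurd hNge (not_le.2 hδ)
  -- the Type-I extremality passes to the limit
  have hhot : ∀ t < 0, ∀ x, Real.sqrt (-t) * |W t x 2| ≤ |W (-1) 0 2| := by
    intro t ht x
    have hlim : Tendsto (fun j => Real.sqrt (-t) * |vs (φ j) t x 2|) atTop (𝓝 (Real.sqrt (-t) * |W t x 2|)) :=
      ((continuous_const.mul continuous_abs).tendsto _).comp (hval t ht x)
    exact le_of_tendsto_of_tendsto hlim hNabs (Eventually.of_forall fun j => (hP (φ j)).2.2.2.2.2.2.1 t ht x)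
  -- the pins re-derive themselves by Fermat at the hot spot of the limit
  have hPW : Pinned C W :=
    ⟨hrate, hcont, hmild, hdiv, hpol, hne, hhot,
      PoloidalWindowDoorLrcModEntireThreadPins.threadPin_of_hotSpot hrate hcont hmild hhot,
      PoloidalWindowDoorLrcModEntireThreadPins.threadSignedPin C W hrate hcont hmild hdiv hne hhot⟩
  -- `Peakless` passes to the limit
  have hKW : Peakless W :=
    PoloidalWindowDoorPoloidalWindowRigidityHotHullCompactness.peaklessClosed (fun j => vs (φ j)) W (fun j => hK (φ j))
      (fun j t ht => PoloidalWindowDoorPoloidalWindowRigidityHotHullCompactness.continuous_slice_of_class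
        (hP (φ j)).1 (hP (φ j)).2.1 (hP (φ j)).2.2.1 (hP (φ j)).2.2.2.1 ht)
      (fun t ht => PoloidalWindowDoorPoloidalWindowRigidityHotHullCompactness.continuous_slice_of_class hrate hcont hmild hdiv ht)
      (fun t ht => htlu t ht)
  -- vorticity slices converge locally uniformly: `curl = curlCLM ∘ D`
  have hcurl : TendstoLocallyUniformly (fun j => curl (vs (φ j) (-1))) (curl (W (-1))) atTop := by
    have e1 : (fun j => curl (vs (φ j) (-1))) = fun j => curlCLM ∘ fderiv ℝ (vs (φ j) (-1)) := by
      funext j x; exact curl_eq_curlCLM _ _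
    have e2 : curl (W (-1)) = curlCLM ∘ fderiv ℝ (W (-1)) := by
      funext x; exact curl_eq_curlCLM _ _
    rw [e1, e2]
    exact curlCLM.uniformContinuous.comp_tendstoLocallyUniformly (htlufd (-1) (by norm_num))
  exact ⟨φ, W, hφ, hPW, hKW, fun t ht => htlu t ht, hcurl⟩

/-! ## §5 LEAST-PIN profiles exist (PROVED from U3a) -/

/-- **Least pin.**  `v` has the least pin value among all pinned peakless class-`C` profiles. -/
def LeastPin (C : ℝ) (v : ℝ → EuclideanSpace ℝ (Fin 3) → EuclideanSpace ℝ (Fin 3)) : Prop :=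
  ∀ v' : ℝ → EuclideanSpace ℝ (Fin 3) → EuclideanSpace ℝ (Fin 3), Pinned C v' → Peakless v' → |v (-1) 0 2| ≤ |v' (-1) 0 2|

/-- **A least-pin profile exists (PROVED)**: if the pinned–peakless class 𝒫(C) is nonempty it contains a profile of least `|N|` (minimising sequence; the infimum is
`≥ δ(C) > 0` by `pin_lower_bound`, so `pinnedCompact` applies and the limit is a non-degenerate pinned peakless profile whose pin value is the infimum). -/
theorem exists_leastPin (hAG : AnisotropicGap) {C : ℝ} {v₀ : ℝ → EuclideanSpace ℝ (Fin 3) → EuclideanSpace ℝ (Fin 3)}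
    (hP₀ : Pinned C v₀) (hK₀ : Peakless v₀) :
    ∃ U : ℝ → EuclideanSpace ℝ (Fin 3) → EuclideanSpace ℝ (Fin 3), Pinned C U ∧ Peakless U ∧ LeastPin C U := by
  obtain ⟨δ, hδ, hδle⟩ := pin_lower_bound hAG C
  set S : Set ℝ := {r | ∃ v' : ℝ → EuclideanSpace ℝ (Fin 3) → EuclideanSpace ℝ (Fin 3), Pinned C v' ∧ Peakless v' ∧ r = |v' (-1) 0 2|}
    with hS
  have hSne : S.Nonempty := ⟨_, v₀, hP₀, hK₀, rfl⟩
  have hSδ : ∀ r ∈ S, δ ≤ r := by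
    rintro r ⟨v', hP', -, rfl⟩
    exact hδle v' hP'
  have hSbdd : BddBelow S := ⟨δ, hSδ⟩
  set m : ℝ := sInf S with hm
  have hmle : ∀ r ∈ S, m ≤ r := fun r hr => csInf_le hSbdd hr
  have hkpos : ∀ k : ℕ, (0 : ℝ) < 1 / ((k : ℝ) + 1) := fun k => by positivity
  have hseq : ∀ k : ℕ, ∃ r ∈ S, r < m + 1 / ((k : ℝ) + 1) := fun k =>
    exists_lt_of_csInf_lt hSne (by linarith [hkpos k])
  choose r hrS hrlt using hseq
  have hvs : ∀ k, ∃ v' : ℝ → EuclideanSpace ℝ (Fin 3) → EuclideanSpace ℝ (Fin 3), Pinned C v' ∧ Peakless v' ∧ r k = |v' (-1) 0 2| :=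
    fun k => hrS k
  choose vs hPk hKk hrk using hvs
  obtain ⟨φ, U, hφ, hPU, hKU, hconv, -⟩ :=
    pinnedCompact C δ vs hδ hPk hKk (fun k => (hrk k) ▸ hSδ _ (hrS k))
  -- the pin value of `U` is the infimum `m`
  have hc2 : Continuous fun x : EuclideanSpace ℝ (Fin 3) => x 2 := by fun_prop
  have hval : Tendsto (fun j => |vs (φ j) (-1) 0 2|) atTop (𝓝 |U (-1) 0 2|) :=
    (continuous_abs.tendsto _).comp ((hc2.tendsto _).comp
      (((hconv (-1) (by norm_num)).tendstoLocallyUniformlyOn (s := Set.univ)).tendsto_at (Set.mem_univ 0)))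
  have hup : ∀ j : ℕ, |vs (φ j) (-1) 0 2| ≤ m + 1 / ((j : ℝ) + 1) := by
    intro j
    rw [← hrk (φ j)]
    refine (hrlt (φ j)).le.trans ?_
    have hj : (j : ℝ) ≤ ((φ j : ℕ) : ℝ) := by exact_mod_cast hφ.id_le j
    have hj1 : (j : ℝ) + 1 ≤ ((φ j : ℕ) : ℝ) + 1 := by linarith
    have hjpos : (0 : ℝ) < (j : ℝ) + 1 := by positivity
    have hdiv' : 1 / (((φ j : ℕ) : ℝ) + 1) ≤ 1 / ((j : ℝ) + 1) := one_div_le_one_div_of_le hjpos hj1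
    linarith
  have hlow : ∀ j : ℕ, m ≤ |vs (φ j) (-1) 0 2| := by
    intro j
    rw [← hrk (φ j)]
    exact hmle _ (hrS _)
  have hlim1 : Tendsto (fun j : ℕ => m + 1 / ((j : ℝ) + 1)) atTop (𝓝 m) := by
    have h0 : Tendsto (fun j : ℕ => 1 / ((j : ℝ) + 1)) atTop (𝓝 0) := tendsto_one_div_add_atTop_nhds_zero_nat
    have h1 := h0.const_add m
    simpa using h1
  have hNm : |U (-1) 0 2| = m :=
    le_antisymm (le_of_tendsto_of_tendsto hval hlim1 (Eventually.of_forall hup)) (ge_of_tendsto hval (Eventually.of_forall hlow))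
  refine ⟨U, hPU, hKU, fun v' hP' hK' => ?_⟩
  rw [hNm]
  exact hmle _ ⟨v', hP', hK', rfl⟩

/-- Least pin is a property of the pin VALUE: the translate of a least-pin profile to any of its hot points is again least-pin (with hot_hull H1
`pinned_translate` / `peakless_translate` this makes every hot point of a least-pin profile a least pin). -/
theorem leastPin_hot_translate {C : ℝ} {v : ℝ → EuclideanSpace ℝ (Fin 3) → EuclideanSpace ℝ (Fin 3)} (hL : LeastPin C v)
    {y : EuclideanSpace ℝ (Fin 3)} (hy : y ∈ hotSet v) : LeastPin C (fun t x => v t (x + y)) := by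
  intro v' hP' hK'
  have h : (fun t x => v t (x + y)) (-1) 0 2 = v (-1) 0 2 := by
    show v (-1) (0 + y) 2 = v (-1) 0 2
    rw [zero_add]
    exact hy.2
  rw [h]
  exact hL v' hP' hK'

/-! ## §6 U3b — NO-PIN-LOSS for least-pin profiles (hand, M) -/

/-- **No pin loss.**  Every class-`C`, e₂-poloidal, peakless profile `V ≢ 0` dominated by the pin of `v` (`√(−t)|V₂| ≤ |N|` everywhere) carries the FULL pin:
`sup √(−t)|V₂| = |N|`.  (The domination is automatic for every renormalisation descendant of `v` — blow-downs, tangent flows, spatial-translation limits,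
time-shifts, hot-hull limits — so each of them is `0` or full-pin.) -/
def NoPinLoss (C : ℝ) (v : ℝ → EuclideanSpace ℝ (Fin 3) → EuclideanSpace ℝ (Fin 3)) : Prop :=
  ∀ V : ℝ → EuclideanSpace ℝ (Fin 3) → EuclideanSpace ℝ (Fin 3), IsTypeIAncientMild C V →
    (∀ s < 0, ∀ y, ⟪curl (V s) y, EuclideanSpace.single 2 1⟫_ℝ = 0) → Peakless V →
    (∀ t < 0, ∀ x, Real.sqrt (-t) * |V t x 2| ≤ |v (-1) 0 2|) → (¬ ∀ t < 0, ∀ x, V t x = 0) →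
    ∀ η > 0, ∃ t < 0, ∃ x, |v (-1) 0 2| - η < Real.sqrt (-t) * |V t x 2|

/-- **stub U3b `NoPinLoss` for least-pin profiles — LANDED (v1.1)**: p709332 ACCEPTED 08:29:04Z `Theorems/PoloidalWindowDoorPoloidalWindowRigidityLeastPinNoPinLoss.lean`
(ns-es-p1 g8), decl `…LeastPinNoPinLoss.noPinLoss` = this statement VERBATIM (+ S-lemma `peakless_nsRescale`); wired BY NAME.  Original hand brief:  Proof for the hand: if `m' := sup √(−t)|V₂| < |N|` (`m' > 0` by
`vertical_nonvanishing`), take near-sup points `(t_k, x_k)`; the renormalised fields `√(−t_k)·V(−t_k s, x_k + √(−t_k) y)` are class `C`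
(`isTypeIAncientMild_zoomTranslate`), e₂-poloidal (`poloidal_nsRescale`, `poloidal_translate`), peakless (`peakless_translate` + the S-lemma «`Peakless` is
invariant under `nsRescale c`, `c > 0`»: horizontal planes and island brackets are mapped to horizontal planes and island brackets), dominated by `m'`, with
`|(·)₂(−1,0)| → m'`; a KNSS limit with gradients (`exists_tendsto_of_isTypeIAncientMild_seq`) is class `C`, poloidal (`poloidal_of_tendsto`), peakless
(`peaklessClosed`), attains `m' = |V̄₂(−1,0)|` with `√(−t)|V̄₂| ≤ m'` — hence PINNED by Fermat (`threadPin_of_hotSpot`, `threadSignedPin`, as in `pinnedCompact`) —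
with pin value `m' < |N|`: this contradicts `LeastPin C v`.  TEMPLATE: tree p469616 (`exists_poloidal_extremal`: near-maximal points + renormalisation +
gradient limit). -/
theorem stub_noPinLoss : AnisotropicGap → ∀ (C : ℝ) (v : ℝ → EuclideanSpace ℝ (Fin 3) → EuclideanSpace ℝ (Fin 3)),
    Pinned C v → Peakless v → LeastPin C v → NoPinLoss C v :=
  Summit.NavierStokesRegularity.NavierStokesRegularity.Theorems.PoloidalWindowDoorPoloidalWindowRigidityLeastPinNoPinLoss.noPinLoss

/-- Corner of U3b that needs no hand: the pin of `v` itself is dominated and attained (`t = −1`, `x = 0`). -/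
theorem noPinLoss_self {C : ℝ} {v : ℝ → EuclideanSpace ℝ (Fin 3) → EuclideanSpace ℝ (Fin 3)} (hP : Pinned C v) :
    ∀ η > 0, ∃ t < 0, ∃ x, |v (-1) 0 2| - η < Real.sqrt (-t) * |v t x 2| := by
  intro η hη
  refine ⟨-1, by norm_num, 0, ?_⟩
  have h1 : Real.sqrt (-(-1 : ℝ)) = 1 := by norm_num
  rw [h1, one_mul]
  linarith


/-! ## §7 THICKNESS of the least-pin profile at its pin, mod the (TH)-germ = S0 — hot_hull v1.7 H2, VERBATIM (S0 entering as a HYPOTHESIS) -/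

/-- **S0 ((TH) column's `stub_localTHEmptyHypNUGRS`), as a statement** — VERBATIM the type of hot_split / hot_hull / twist_split's shared stub; this line takes it
as an explicit binder `hS0` instead of a sorried stub. -/
def S0Statement : Prop :=
    ∀ (u : ℝ → EuclideanSpace ℝ (Fin 3) → EuclideanSpace ℝ (Fin 3)) (μ A : ℝ → ℝ → ℝ)
      (U : Set (ℝ × EuclideanSpace ℝ (Fin 3))) (p₀ : ℝ × EuclideanSpace ℝ (Fin 3)),
      IsOpen U → p₀ ∈ U →
      AnalyticOnNhd ℝ (Function.uncurry u) U →
      (∀ p ∈ U, AnalyticAt ℝ (Function.uncurry μ) (p.1, p.2 2)) →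
      (∀ p ∈ U, AnalyticAt ℝ (Function.uncurry A) (p.1, p.2 2)) →
      (∀ p ∈ U, fderiv ℝ (u p.1) p.2 (EuclideanSpace.single 0 1) 1 = fderiv ℝ (u p.1) p.2 (EuclideanSpace.single 1 1) 0) →
      (∀ p ∈ U, fderiv ℝ (u p.1) p.2 (EuclideanSpace.single 0 1) 0 + fderiv ℝ (u p.1) p.2 (EuclideanSpace.single 1 1) 1 +
        fderiv ℝ (u p.1) p.2 (EuclideanSpace.single 2 1) 2 = 0) →
      (∀ p ∈ U, ∀ b : Fin 3, b ≠ 2 →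
        fderiv ℝ (u p.1) p.2 (EuclideanSpace.single 2 1) b =
          μ p.1 (p.2 2) * fderiv ℝ (u p.1) p.2 (EuclideanSpace.single b 1) 2) →
      (∀ p ∈ U,
        (1 - μ p.1 (p.2 2)) *
            (deriv (fun s => u s p.2 2) p.1 + fderiv ℝ (fun y => u p.1 y 2) p.2 (u p.1 p.2)
              - Δ (fun y => u p.1 y 2) p.2) =
          A p.1 (p.2 2) + (deriv (fun s => μ s (p.2 2)) p.1 - deriv (deriv (μ p.1)) (p.2 2)) * u p.1 p.2 2
            + deriv (μ p.1) (p.2 2) / 2 * u p.1 p.2 2 ^ 2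
            - 2 * deriv (μ p.1) (p.2 2) * fderiv ℝ (u p.1) p.2 (EuclideanSpace.single 2 1) 2) →
      fderiv ℝ (fun y => fderiv ℝ (u p₀.1) y (EuclideanSpace.single 2 1) 2) p₀.2 (EuclideanSpace.single 0 1) *
            fderiv ℝ (u p₀.1) p₀.2 (EuclideanSpace.single 1 1) 2 -
          fderiv ℝ (fun y => fderiv ℝ (u p₀.1) y (EuclideanSpace.single 2 1) 2) p₀.2 (EuclideanSpace.single 1 1) *
            fderiv ℝ (u p₀.1) p₀.2 (EuclideanSpace.single 0 1) 2 ≠ 0 →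
      μ p₀.1 (p₀.2 2) ≠ 0 → μ p₀.1 (p₀.2 2) ≠ 1 → deriv (μ p₀.1) (p₀.2 2) ≠ 0 →
      μ p₀.1 (p₀.2 2) < 0 →
      (fderiv ℝ (u p₀.1) p₀.2 (EuclideanSpace.single 0 1) 0 ≠ fderiv ℝ (u p₀.1) p₀.2 (EuclideanSpace.single 1 1) 1 ∨
        fderiv ℝ (u p₀.1) p₀.2 (EuclideanSpace.single 1 1) 0 ≠ 0) →
      u p₀.1 p₀.2 = 0 →
      fderiv ℝ (u p₀.1) p₀.2 (EuclideanSpace.single 0 1) 2 = 0 →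
      fderiv ℝ (u p₀.1) p₀.2 (EuclideanSpace.single 1 1) 2 = 1 → False

/-- **The (TH)-germ statement** — VERBATIM hot_hull v1.7 `THGerm` (the conclusion of tree `…TwistingTHLocalHypGerm.stub_twistingTH_of_localEmptyHyp`). -/
def THGerm : Prop :=
  ∀ (C : ℝ) (v : ℝ → EuclideanSpace ℝ (Fin 3) → EuclideanSpace ℝ (Fin 3)),
    Literature.Analysis.FluidPDE.HasTypeITimeDecay C v →
    ContinuousOn (Function.uncurry v) (Set.Iio (0 : ℝ) ×ˢ Set.univ) →
    (∀ s t : ℝ, s < t → t < 0 → ∀ x, v t x =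
      Literature.Analysis.UnboundedOperators.heatExtension (v s) (t - s) x -
        Literature.Analysis.FluidPDE.oseenDuhamel 1 s v v t x) →
    (∀ t < 0, Literature.Analysis.FluidPDE.VectorCalculus.IsDivFree (v t)) →
    (∀ s < 0, ∀ y, ⟪Literature.Analysis.FluidPDE.curl (v s) y, EuclideanSpace.single 2 1⟫_ℝ = 0) →
    ∀ W : Set (ℝ × EuclideanSpace ℝ (Fin 3)), IsOpen W → W.Nonempty → W ⊆ Set.Iio (0 : ℝ) ×ˢ Set.univ →
      (∀ z ∈ W, (Literature.Analysis.FluidPDE.curl (v z.1) z.2 ≠ 0 ∧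
          (fderiv ℝ (v z.1) z.2 (EuclideanSpace.single 0 1) 2 ≠ 0 ∨ fderiv ℝ (v z.1) z.2 (EuclideanSpace.single 1 1) 2 ≠ 0) ∧
          (fderiv ℝ (v z.1) z.2 (EuclideanSpace.single 2 1) 0 ≠ 0 ∨ fderiv ℝ (v z.1) z.2 (EuclideanSpace.single 2 1) 1 ≠ 0))) →
      (∀ m : ℝ → ℝ, ∀ W₁ : Set (ℝ × EuclideanSpace ℝ (Fin 3)), W₁ ⊆ W → IsOpen W₁ → W₁.Nonempty →
          ∃ z ∈ W₁, ∃ b : Fin 3, b ≠ 2 ∧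
            fderiv ℝ (v z.1) z.2 (EuclideanSpace.single 2 1) b ≠
              m z.1 * fderiv ℝ (v z.1) z.2 (EuclideanSpace.single b 1) 2) →
      (∀ z ∈ W, (fderiv ℝ (fun x => fderiv ℝ (v z.1) x (EuclideanSpace.single 2 1) 2) z.2 (EuclideanSpace.single 0 1) *
              fderiv ℝ (v z.1) z.2 (EuclideanSpace.single 1 1) 2 -
            fderiv ℝ (fun x => fderiv ℝ (v z.1) x (EuclideanSpace.single 2 1) 2) z.2 (EuclideanSpace.single 1 1) *
              fderiv ℝ (v z.1) z.2 (EuclideanSpace.single 0 1) 2 ≠ 0)) →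
      (∃ m : ℝ → ℝ → ℝ, ∀ z ∈ W, ∀ b : Fin 3, b ≠ 2 →
          fderiv ℝ (v z.1) z.2 (EuclideanSpace.single 2 1) b =
            m z.1 (z.2 2) * fderiv ℝ (v z.1) z.2 (EuclideanSpace.single b 1) 2) →
      ∃ s : ℝ, s < 0 ∧ ∃ U : Set (EuclideanSpace ℝ (Fin 3)), IsOpen U ∧ U.Nonempty ∧
        ((∃ e : EuclideanSpace ℝ (Fin 3), e ≠ 0 ∧
            ∀ y ∈ U, fderiv ℝ (Literature.Analysis.FluidPDE.curl (v s)) y e = 0) ∨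
         (∃ c : EuclideanSpace ℝ (Fin 3), ∀ y ∈ U,
            Literature.Analysis.FluidPDE.rotGen (Literature.Analysis.FluidPDE.curl (v s) y) =
              fderiv ℝ (Literature.Analysis.FluidPDE.curl (v s)) y (Literature.Analysis.FluidPDE.rotGen (y - c))) ∨
         (∃ w : EuclideanSpace ℝ (Fin 3) → EuclideanSpace ℝ (Fin 3), AnalyticOnNhd ℝ w Set.univ ∧
            ¬ BddAbove (Set.range fun y => ‖w y‖) ∧ ∀ y ∈ U, v s y = w y))

/-- **THGerm ⇐ S0, BY NAME** through the tree chain `localTHEmptyHypNF_of_normalFormRS` → `localTHEmptyHypNonUmbilic_of_galilean` →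
`localTHEmptyHyp_of_localTHEmptyHypNonUmbilic` → `stub_twistingTH_of_localEmptyHyp` (all landed) — hot_hull's `thGerm_holds` with S0 as the binder `hS0`. -/
theorem thGerm_of_S0 (hS0 : S0Statement) : THGerm :=
  PoloidalWindowDoorLrcModEntireTwistingTHLocalHypGerm.stub_twistingTH_of_localEmptyHyp
    (PoloidalWindowDoorLrcModEntireTwistingTHLocalNonUmbilic.localTHEmptyHyp_of_localTHEmptyHypNonUmbilic
      (PoloidalWindowDoorLrcModEntireTwistingTHLocalGalilean.localTHEmptyHypNonUmbilic_of_galilean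
        (PoloidalWindowDoorLrcModEntireTwistingTHLocalNormalFormRS.localTHEmptyHypNF_of_normalFormRS hS0)))

/-- **H2 `ThickDense`**: given the (TH)-germ statement, EVERY space-time point `z₀` (with `z₀.1 < 0`) of EVERY pinned profile carries a thick window
accumulating at `z₀`.  (So thickness is not a property of the pin: it holds everywhere, off the leaf included — the theorem form of the g9 seed
"use thickness off the leaf".) -/
def ThickDense : Prop :=
  THGerm → ∀ (C : ℝ) (v : ℝ → EuclideanSpace ℝ (Fin 3) → EuclideanSpace ℝ (Fin 3)), Pinned C v →
    ∀ z₀ : ℝ × EuclideanSpace ℝ (Fin 3), z₀.1 < 0 → ∃ W : Set (ℝ × EuclideanSpace ℝ (Fin 3)), ThickWindowAt v W z₀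

/-- **H2 PROVED** from the tree: `…ThreadDichotomy.threadDichotomy` (5 cases) at `z₀`; case (i) IS a thick window at `z₀`; (ii) untwisted ⇒ a germ by
tree `…UntwistedGerm.stub_untwistedGerm` ⇒ absurd on a non-degenerate window by tree `…LrcModEntireIff.false_of_germ_of_nondegenerate`; (iii) (TH) ⇒ the
same via `THGerm`; (iv) time-only slope ⇒ `v ≡ 0` by tree `…FarThreadReduction.eq_zero_of_local_timeOnlySlope`; (v) degenerate ⇒ `v ≡ 0` by tree
`…SymmetryGerms.eq_zero_of_curl_eq_zero_on_open` / `eq_zero_of_horizontalGradient_eq_zero_on_open` / `…VerticalShearGerm.eq_zero_of_verticalShear_eq_zero_on_open`;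
`v ≡ 0` contradicts `N ≠ 0`. -/
theorem thickDense_holds : ThickDense := by
  intro hTH C v hP z₀ hz₀
  obtain ⟨hrate, hcont, hmild, hdiv, hpol, hne, -, -, -⟩ := hP
  have habs : ¬ (∀ t < 0, ∀ x, v t x = 0) := fun h0 => hne (by rw [h0 (-1) (by norm_num) 0]; rfl)
  have hgermAbs : ∀ W : Set (ℝ × EuclideanSpace ℝ (Fin 3)), W.Nonempty → W ⊆ Set.Iio (0 : ℝ) ×ˢ Set.univ →
      (∀ z ∈ W, Literature.Analysis.FluidPDE.curl (v z.1) z.2 ≠ 0 ∧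
          (fderiv ℝ (v z.1) z.2 (EuclideanSpace.single 0 1) 2 ≠ 0 ∨ fderiv ℝ (v z.1) z.2 (EuclideanSpace.single 1 1) 2 ≠ 0) ∧
          (fderiv ℝ (v z.1) z.2 (EuclideanSpace.single 2 1) 0 ≠ 0 ∨ fderiv ℝ (v z.1) z.2 (EuclideanSpace.single 2 1) 1 ≠ 0)) →
      (∃ s : ℝ, s < 0 ∧ ∃ U : Set (EuclideanSpace ℝ (Fin 3)), IsOpen U ∧ U.Nonempty ∧
        ((∃ e : EuclideanSpace ℝ (Fin 3), e ≠ 0 ∧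
            ∀ y ∈ U, fderiv ℝ (Literature.Analysis.FluidPDE.curl (v s)) y e = 0) ∨
         (∃ c : EuclideanSpace ℝ (Fin 3), ∀ y ∈ U,
            Literature.Analysis.FluidPDE.rotGen (Literature.Analysis.FluidPDE.curl (v s) y) =
              fderiv ℝ (Literature.Analysis.FluidPDE.curl (v s)) y (Literature.Analysis.FluidPDE.rotGen (y - c))) ∨
         (∃ w : EuclideanSpace ℝ (Fin 3) → EuclideanSpace ℝ (Fin 3), AnalyticOnNhd ℝ w Set.univ ∧
            ¬ BddAbove (Set.range fun y => ‖w y‖) ∧ ∀ y ∈ U, v s y = w y))) → False := by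
    intro W hWne hWs hnd hgerm
    obtain ⟨z₁, hz₁⟩ := hWne
    obtain ⟨s, hs', U, hU, hUne, hg⟩ := hgerm
    exact PoloidalWindowDoorLrcModEntireIff.false_of_germ_of_nondegenerate hrate hcont hmild hdiv hpol
      (Set.mem_prod.1 (hWs hz₁)).1 (hnd z₁ hz₁).1 hs' hU hUne hg
  rcases PoloidalWindowDoorLrcModEntireThreadDichotomy.threadDichotomy C v hrate hcont hmild hdiv hpol z₀ hz₀ with
    ⟨W, hW, hWs, hndtw, hthick, hacc⟩ | ⟨W, hW, hWne, hWs, hnd, htw0⟩ | ⟨W, hW, hWne, hWs, hnd, hpin', htw, hTH'⟩ |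
    ⟨W, hW, hWne, hWs, m, hm⟩ | ⟨s, hs', U, hU, hUne, hdeg⟩
  · exact ⟨W, hW, hWs, hndtw, hthick, hacc⟩
  · exact (hgermAbs W hWne hWs hnd (PoloidalWindowDoorLrcModEntireUntwistedGerm.stub_untwistedGerm C v hrate hcont hmild hdiv hpol
      W hW hWne hWs hnd htw0)).elim
  · exact (hgermAbs W hWne hWs hnd (hTH C v hrate hcont hmild hdiv hpol W hW hWne hWs hnd hpin' htw hTH')).elim
  · exact (habs (PoloidalWindowDoorLrcModEntireFarThreadReduction.eq_zero_of_local_timeOnlySlope hrate hcont hmild hdiv hpol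
      hW hWne hWs hm)).elim
  · rcases hdeg with hcurl | hflat | hrig
    · exact (habs (PoloidalWindowDoorPoloidalWindowRigiditySymmetryGerms.eq_zero_of_curl_eq_zero_on_open hrate hcont hmild hdiv
        hs' hU hUne hcurl)).elim
    · exact (habs (PoloidalWindowDoorPoloidalWindowRigiditySymmetryGerms.eq_zero_of_horizontalGradient_eq_zero_on_open hrate hcont hmild hdiv
        hs' (hpol s hs') hU hUne fun y hy => (hflat y hy).1)).elim
    · exact (habs (PoloidalWindowDoorPoloidalWindowRigidityVerticalShearGerm.eq_zero_of_verticalShear_eq_zero_on_open hrate hcont hmild hdiv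
        hs' hU hUne hrig)).elim

/-- **H2 at the pin of any pinned profile**: `ThickDense → THGerm → ∃ W, ThickWindow v W` (`ThickWindowAt v W (−1,0)` is `ThickWindow v W` definitionally). -/
theorem thickWindow_of_dense (hTD : ThickDense) (hTH : THGerm) {C : ℝ} {v : ℝ → EuclideanSpace ℝ (Fin 3) → EuclideanSpace ℝ (Fin 3)}
    (hP : Pinned C v) : ∃ W : Set (ℝ × EuclideanSpace ℝ (Fin 3)), ThickWindow v W :=
  hTD hTH C v hP ((-1 : ℝ), (0 : EuclideanSpace ℝ (Fin 3))) (by show (-1 : ℝ) < 0; norm_num)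

/-! ## §8 The research cell LEAST-PIN (OPEN): HL3′'s binders + least pin + no-pin-loss + the gap as data -/

/-- **Research cell LEAST-PIN (OPEN).**  Kill a pinned, thick, peakless class-`C` profile which in addition is a LEAST-PIN profile obeying NO-PIN-LOSS, the
anisotropic gap being available as data.  Every cut of HL3′ in the column whose kernel fixes `(v, W)` (hot_split C2a′/C2b′, leaf_uniform, null_leaf,
hot_forest, hot_hull RECURRENT-LEAF / ESC-END, uniform_return DEFECTIVE-RETURN-LEAF, eternal_core …-CORE) may thread the two extra binders through its own
kernel unchanged (mechanical, S), so each of those cells inherits the WLOG.  Compatible normal forms (not restated here): `C = C⋆` least (tree H1,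
`exists_poloidal_extremal`), hot-point re-centring (hot_hull H1 + `leastPin_hot_translate`). -/
def CellLeastPin : Prop :=
  AnisotropicGap →
  ∀ (C : ℝ) (v : ℝ → EuclideanSpace ℝ (Fin 3) → EuclideanSpace ℝ (Fin 3)) (W : Set (ℝ × EuclideanSpace ℝ (Fin 3))),
    Pinned C v → ThickWindow v W → Peakless v → LeastPin C v → NoPinLoss C v → False

/-! ## §9 Kernel (checked, no sorry): HL3′ ⇐ U3a ∧ U3b ∧ THGerm ∧ LEAST-PIN -/

/-- **HL3′** — VERBATIM the statement of hot_loops v4.3 `stub_peaklessEmpty` = hot_hull v1.7 `hotHull_peaklessEmpty` = the third argument of the tree's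
`…HotLoopsReduction.poloidalWindowRigidity_of_NUGRS_of_growth_of_peakless`. -/
def HL3' : Prop :=
    ∀ (C : ℝ) (v : ℝ → EuclideanSpace ℝ (Fin 3) → EuclideanSpace ℝ (Fin 3)),
      Literature.Analysis.FluidPDE.HasTypeITimeDecay C v →
      ContinuousOn (Function.uncurry v) (Set.Iio (0 : ℝ) ×ˢ Set.univ) →
      (∀ s t : ℝ, s < t → t < 0 → ∀ x, v t x =
        Literature.Analysis.UnboundedOperators.heatExtension (v s) (t - s) x -
          Literature.Analysis.FluidPDE.oseenDuhamel 1 s v v t x) →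
      (∀ t < 0, Literature.Analysis.FluidPDE.VectorCalculus.IsDivFree (v t)) →
      (∀ s < 0, ∀ y, ⟪Literature.Analysis.FluidPDE.curl (v s) y, EuclideanSpace.single 2 1⟫_ℝ = 0) →
      v (-1) 0 2 ≠ 0 → (∀ t < 0, ∀ x, Real.sqrt (-t) * |v t x 2| ≤ |v (-1) 0 2|) →
      (∀ h : EuclideanSpace ℝ (Fin 3), fderiv ℝ (v (-1)) 0 h 2 = 0) →
      (deriv (fun s => v s 0 2) (-1) = v (-1) 0 2 / 2 ∧ v (-1) 0 2 * (Δ (fun y => v (-1) y 2)) 0 ≤ 0) →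
      ∀ W : Set (ℝ × EuclideanSpace ℝ (Fin 3)), IsOpen W → W ⊆ Set.Iio (0 : ℝ) ×ˢ Set.univ →
        (∀ z ∈ W, (Literature.Analysis.FluidPDE.curl (v z.1) z.2 ≠ 0 ∧
            (fderiv ℝ (v z.1) z.2 (EuclideanSpace.single 0 1) 2 ≠ 0 ∨ fderiv ℝ (v z.1) z.2 (EuclideanSpace.single 1 1) 2 ≠ 0) ∧
            (fderiv ℝ (v z.1) z.2 (EuclideanSpace.single 2 1) 0 ≠ 0 ∨ fderiv ℝ (v z.1) z.2 (EuclideanSpace.single 2 1) 1 ≠ 0)) ∧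
          (fderiv ℝ (fun x => fderiv ℝ (v z.1) x (EuclideanSpace.single 2 1) 2) z.2 (EuclideanSpace.single 0 1) *
                fderiv ℝ (v z.1) z.2 (EuclideanSpace.single 1 1) 2 -
              fderiv ℝ (fun x => fderiv ℝ (v z.1) x (EuclideanSpace.single 2 1) 2) z.2 (EuclideanSpace.single 1 1) *
                fderiv ℝ (v z.1) z.2 (EuclideanSpace.single 0 1) 2 ≠ 0)) →
        (∀ m : ℝ → ℝ → ℝ, ∀ W₁ : Set (ℝ × EuclideanSpace ℝ (Fin 3)), W₁ ⊆ W → IsOpen W₁ → W₁.Nonempty →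
            ∃ z ∈ W₁, ∃ b : Fin 3, b ≠ 2 ∧
              fderiv ℝ (v z.1) z.2 (EuclideanSpace.single 2 1) b ≠
                m z.1 (z.2 2) * fderiv ℝ (v z.1) z.2 (EuclideanSpace.single b 1) 2) →
        (∀ r : ℝ, 0 < r → (Metric.ball ((-1 : ℝ), (0 : EuclideanSpace ℝ (Fin 3))) r ∩ W).Nonempty) →
        (∀ (s z₀ σ M : ℝ) (K O : Set (EuclideanSpace ℝ (Fin 3))), s < 0 →
          ((σ = 1 ∨ σ = -1) ∧ IsCompact K ∧ K.Nonempty ∧ (∀ y ∈ K, y 2 = z₀ ∧ σ * v s y 2 = M) ∧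
            IsOpen O ∧ K ⊆ O ∧ (∀ y ∈ O, y 2 = z₀ → σ * v s y 2 ≤ M) ∧
            (∀ y ∈ O, y 2 = z₀ → σ * v s y 2 = M → y ∈ K)) → False) →
        False

/-- **The universal WLOG (PROVED):** HL3′ follows from the gap U3a, the no-pin-loss law U3b for least-pin profiles, the (TH)-germ statement and the cell
LEAST-PIN — given HL3′'s profile `v` (pinned, thick, peakless), the class 𝒫(C) is nonempty, so a least-pin profile `U` exists (`exists_leastPin`), it is thick at
its pin (`thickWindow_of_dense thickDense_holds`, mod THGerm), peakless, least-pin and obeys no-pin-loss: the cell kills it. -/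
theorem hl3_of_leastPin (hAG : AnisotropicGap)
    (hNPL : ∀ (C : ℝ) (v : ℝ → EuclideanSpace ℝ (Fin 3) → EuclideanSpace ℝ (Fin 3)), Pinned C v → Peakless v → LeastPin C v → NoPinLoss C v)
    (hTH : THGerm) (hcell : CellLeastPin) : HL3' := by
  intro C v hrate hcont hmild hdiv hpol hne hext hgrad hpins W hWo hWs hnd hsl hacc hpeak
  have hP : Pinned C v := ⟨hrate, hcont, hmild, hdiv, hpol, hne, hext, hgrad, hpins⟩
  have hK : Peakless v := hpeak
  obtain ⟨U, hPU, hKU, hLU⟩ := exists_leastPin hAG hP hK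
  obtain ⟨W', hW'⟩ := thickWindow_of_dense thickDense_holds hTH hPU
  exact hcell hAG C U W' hPU hW' hKU hLU (hNPL C U hPU hKU hLU)

/-- The same kernel with the hands discharged by their stubs (v1.1: both PROVED BY NAME — no sorry) — the shape the lead will consume. -/
theorem hl3_of_stubs (hTH : THGerm) (hcell : CellLeastPin) : HL3' :=
  hl3_of_leastPin stub_anisotropicGap (stub_noPinLoss stub_anisotropicGap) hTH hcell

/-! ## §10 Compositions to the crux items BY NAME (CONDITIONAL on S0, the wall ⟨27893⟩, U3a, U3b and the cell; no summit, no crux is proved) -/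

/-- **The crux `PoloidalWindowRigidity` (K2, stmt-NavierStokesRegularity-19708) BY NAME ⇐ S0 ∧ ⟨27893⟩ ∧ U3a ∧ U3b ∧ LEAST-PIN**, through the tree's
`…HotLoopsReduction.poloidalWindowRigidity_of_NUGRS_of_growth_of_peakless` (HL3′ = its third argument, VERBATIM).  CONDITIONAL. -/
theorem PoloidalWindowRigidity_of_leastPin (hS0 : S0Statement)
    (hG : Summit.NavierStokesRegularity.NavierStokesRegularity.Theses.LoopPeriodRatchet.FrequencyGrowthExponent)
    (hAG : AnisotropicGap)
    (hNPL : ∀ (C : ℝ) (v : ℝ → EuclideanSpace ℝ (Fin 3) → EuclideanSpace ℝ (Fin 3)), Pinned C v → Peakless v → LeastPin C v → NoPinLoss C v)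
    (hcell : CellLeastPin) :
    Summit.NavierStokesRegularity.NavierStokesRegularity.Theses.PoloidalWindowDoor.PoloidalWindowRigidity :=
  PoloidalWindowDoorPoloidalWindowRigidityHotLoopsReduction.poloidalWindowRigidity_of_NUGRS_of_growth_of_peakless hS0 hG
    (hl3_of_leastPin hAG hNPL (thGerm_of_S0 hS0) hcell)

/-- **The item `LrcModEntire` (stmt-NavierStokesRegularity-20428) BY NAME ⇐ S0 ∧ ⟨27893⟩ ∧ U3a ∧ U3b ∧ LEAST-PIN.**  CONDITIONAL. -/
theorem LrcModEntire_of_leastPin (hS0 : S0Statement)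
    (hG : Summit.NavierStokesRegularity.NavierStokesRegularity.Theses.LoopPeriodRatchet.FrequencyGrowthExponent)
    (hAG : AnisotropicGap)
    (hNPL : ∀ (C : ℝ) (v : ℝ → EuclideanSpace ℝ (Fin 3) → EuclideanSpace ℝ (Fin 3)), Pinned C v → Peakless v → LeastPin C v → NoPinLoss C v)
    (hcell : CellLeastPin) :
    Summit.NavierStokesRegularity.NavierStokesRegularity.Theses.PoloidalWindowDoor.LrcModEntire :=
  PoloidalWindowDoorPoloidalWindowRigidityHotLoopsReduction.lrcModEntire_of_NUGRS_of_growth_of_peakless hS0 hG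
    (hl3_of_leastPin hAG hNPL (thGerm_of_S0 hS0) hcell)

/-- With the two hands discharged by their stubs. -/
theorem PoloidalWindowRigidity_of_stubs (hS0 : S0Statement)
    (hG : Summit.NavierStokesRegularity.NavierStokesRegularity.Theses.LoopPeriodRatchet.FrequencyGrowthExponent) (hcell : CellLeastPin) :
    Summit.NavierStokesRegularity.NavierStokesRegularity.Theses.PoloidalWindowDoor.PoloidalWindowRigidity :=
  PoloidalWindowRigidity_of_leastPin hS0 hG stub_anisotropicGap (stub_noPinLoss stub_anisotropicGap) hcell

theorem LrcModEntire_of_stubs (hS0 : S0Statement)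
    (hG : Summit.NavierStokesRegularity.NavierStokesRegularity.Theses.LoopPeriodRatchet.FrequencyGrowthExponent) (hcell : CellLeastPin) :
    Summit.NavierStokesRegularity.NavierStokesRegularity.Theses.PoloidalWindowDoor.LrcModEntire :=
  LrcModEntire_of_leastPin hS0 hG stub_anisotropicGap (stub_noPinLoss stub_anisotropicGap) hcell

/-! ## §11 LINE 25 — THE TIME-SHIFT LEVER (PROVED): forward time shifts stay in the class and CONTRACT the scale-invariant speed; PAST PIN -/

/-- **Past time shifts preserve the class** (`s₁ ≤ 0`, `V ↦ V(· + s₁)`): joint smoothness by composing with the smooth shift, the Oseen identity by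
`oseenDuhamel_translate`, the Type-I rate because `√(−t) ≤ √(−(t + s₁))`.  (The tree has the four-clause form `…CriticalStretchingAnalytic.timeShift_class`;
this is the `IsTypeIAncientMild` form.) -/
theorem isTypeIAncientMild_timeShift {C : ℝ} {V : ℝ → EuclideanSpace ℝ (Fin 3) → EuclideanSpace ℝ (Fin 3)} (h : IsTypeIAncientMild C V)
    {s₁ : ℝ} (hs₁ : s₁ ≤ 0) : IsTypeIAncientMild C (fun t => V (t + s₁)) := by
  have hC0 : 0 ≤ C := h.nonneg
  refine ⟨?_, fun t ht => h.2.1 (t + s₁) (by linarith), fun s t hst ht x => ?_, fun t ht x => ?_⟩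
  · have hφ : ContDiff ℝ ((⊤ : ℕ∞) : WithTop ℕ∞) (fun p : ℝ × EuclideanSpace ℝ (Fin 3) => (p.1 + s₁, p.2)) := by fun_prop
    have hmaps : Set.MapsTo (fun p : ℝ × EuclideanSpace ℝ (Fin 3) => (p.1 + s₁, p.2)) (Set.Iio (0 : ℝ) ×ˢ Set.univ)
        (Set.Iio (0 : ℝ) ×ˢ Set.univ) := by
      intro p hp
      have h1 : p.1 < 0 := (Set.mem_prod.1 hp).1
      exact Set.mk_mem_prod (show p.1 + s₁ < 0 by linarith) (Set.mem_univ _)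
    exact (h.1.comp hφ.contDiffOn hmaps).congr fun p _ => rfl
  · have hm := h.2.2.1 (s + s₁) (t + s₁) (by linarith) (by linarith) x
    rw [oseenDuhamel_translate 1 s s₁ V V t x]
    simpa only [add_sub_add_right_eq_sub] using hm
  · have hts : t + s₁ < 0 := by linarith
    refine (h.2.2.2 (t + s₁) hts x).trans ?_
    exact div_le_div_of_nonneg_left hC0 (Real.sqrt_pos.2 (neg_pos.2 ht)) (Real.sqrt_le_sqrt (by linarith))

/-- **PAST PIN (PROVED) — the lever of LINE 25.**  If `NoPinLoss C v` holds (U3b: every admissible profile dominated by `|N|` has full pin in the sup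
sense), then every admissible profile realises its full pin IN THE ARBITRARILY FAR PAST: for every `η > 0` and every `T < 0` there is `(s, x)` with `s < T`
and `√(−s)|V₂(s,x)| > |N| − η`.  Proof: the forward time shift `V(· + s₁)` (`s₁ = t₀/2 < 0`, where `V(t₀,x₀) ≠ 0`) is again admissible (class:
`isTypeIAncientMild_timeShift`; poloidal and peakless slice-wise; dominated because `√(−t) ≤ √(−(t+s₁))`; non-zero at `(t₀/2, x₀)`), so U3b gives it a
near-extremal point `(t, x)` with defect `η′`: `|N| − η′ < √(−t)|V₂(t+s₁,x)| ≤ (√(−t)/√(−t−s₁))·|N|`, which forces `−(t+s₁) > |N|(−s₁)/(2η′) ≥ −T` for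
`η′ ≤ |N|(−s₁)/(2(−T))`. -/
theorem pastPin {C : ℝ} {v : ℝ → EuclideanSpace ℝ (Fin 3) → EuclideanSpace ℝ (Fin 3)} (hN : v (-1) 0 2 ≠ 0) (hNPL : NoPinLoss C v)
    {V : ℝ → EuclideanSpace ℝ (Fin 3) → EuclideanSpace ℝ (Fin 3)} (hV : IsTypeIAncientMild C V)
    (hpol : ∀ s < 0, ∀ y, ⟪curl (V s) y, EuclideanSpace.single 2 1⟫_ℝ = 0) (hK : Peakless V)
    (hdom : ∀ t < 0, ∀ x, Real.sqrt (-t) * |V t x 2| ≤ |v (-1) 0 2|) (hnz : ¬ ∀ t < 0, ∀ x, V t x = 0) :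
    ∀ η > 0, ∀ T < 0, ∃ s < T, ∃ x, |v (-1) 0 2| - η < Real.sqrt (-s) * |V s x 2| := by
  intro η hη T hT
  have hm0 : 0 < |v (-1) 0 2| := abs_pos.2 hN
  -- a point where `V` is non-zero, and the shift `s₁ := t₀ / 2`
  push Not at hnz
  obtain ⟨t₀, ht₀, x₀, hx₀⟩ := hnz
  have hs₁0 : t₀ / 2 < 0 := by linarith
  -- the shifted profile `V' t := V (t + t₀/2)` is admissible
  have hV'c : IsTypeIAncientMild C (fun t => V (t + t₀ / 2)) := isTypeIAncientMild_timeShift hV hs₁0.le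
  have hpol' : ∀ s < 0, ∀ y, ⟪curl ((fun t => V (t + t₀ / 2)) s) y, EuclideanSpace.single 2 1⟫_ℝ = 0 :=
    fun s hs y => hpol (s + t₀ / 2) (by linarith) y
  have hK' : Peakless (fun t => V (t + t₀ / 2)) :=
    fun s z₀ σ M K O hs hcfg => hK (s + t₀ / 2) z₀ σ M K O (by linarith) hcfg
  have hdom' : ∀ t < 0, ∀ x, Real.sqrt (-t) * |(fun t => V (t + t₀ / 2)) t x 2| ≤ |v (-1) 0 2| := by
    intro t ht x
    have hts : t + t₀ / 2 < 0 := by linarith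
    have h1 := hdom (t + t₀ / 2) hts x
    have h2 : Real.sqrt (-t) ≤ Real.sqrt (-(t + t₀ / 2)) := Real.sqrt_le_sqrt (by linarith)
    calc Real.sqrt (-t) * |(fun t => V (t + t₀ / 2)) t x 2| = Real.sqrt (-t) * |V (t + t₀ / 2) x 2| := rfl
      _ ≤ Real.sqrt (-(t + t₀ / 2)) * |V (t + t₀ / 2) x 2| := mul_le_mul_of_nonneg_right h2 (abs_nonneg _)
      _ ≤ |v (-1) 0 2| := h1
  have hnz' : ¬ ∀ t < 0, ∀ x, (fun t => V (t + t₀ / 2)) t x = 0 := by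
    intro h0
    have h1 : V (t₀ - t₀ / 2 + t₀ / 2) x₀ = 0 := h0 (t₀ - t₀ / 2) (by linarith) x₀
    rw [sub_add_cancel] at h1
    exact hx₀ h1
  -- the defect `η'`, small enough to push the near-extremal point before time `T`
  have hq : 0 < |v (-1) 0 2| * (-(t₀ / 2)) / (2 * (-T)) := div_pos (mul_pos hm0 (by linarith)) (by linarith)
  set η' : ℝ := min η (min (|v (-1) 0 2| / 2) (|v (-1) 0 2| * (-(t₀ / 2)) / (2 * (-T)))) with hη'
  have hη'0 : 0 < η' := lt_min hη (lt_min (by linarith) hq)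
  have hη'η : η' ≤ η := min_le_left _ _
  have hη'm : η' ≤ |v (-1) 0 2| / 2 := (min_le_right _ _).trans (min_le_left _ _)
  have hη'T : η' ≤ |v (-1) 0 2| * (-(t₀ / 2)) / (2 * (-T)) := (min_le_right _ _).trans (min_le_right _ _)
  obtain ⟨t, ht, x, hx⟩ := hNPL (fun t => V (t + t₀ / 2)) hV'c hpol' hK' hdom' hnz' η' hη'0
  have hx' : |v (-1) 0 2| - η' < Real.sqrt (-t) * |V (t + t₀ / 2) x 2| := hx
  have hts : t + t₀ / 2 < 0 := by linarith
  refine ⟨t + t₀ / 2, ?_, x, ?_⟩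
  · -- the time estimate
    have hd := hdom (t + t₀ / 2) hts x
    have hsq_t : 0 ≤ Real.sqrt (-t) := Real.sqrt_nonneg _
    have hsq_s : 0 < Real.sqrt (-(t + t₀ / 2)) := Real.sqrt_pos.2 (by linarith)
    -- `(|N| - η')·√(-(t+s₁)) < |N|·√(-t)`
    have key : (|v (-1) 0 2| - η') * Real.sqrt (-(t + t₀ / 2)) < |v (-1) 0 2| * Real.sqrt (-t) := by
      have h1 : (|v (-1) 0 2| - η') * Real.sqrt (-(t + t₀ / 2)) <
          Real.sqrt (-t) * |V (t + t₀ / 2) x 2| * Real.sqrt (-(t + t₀ / 2)) :=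
        mul_lt_mul_of_pos_right hx' hsq_s
      have h2 : Real.sqrt (-t) * |V (t + t₀ / 2) x 2| * Real.sqrt (-(t + t₀ / 2)) ≤ Real.sqrt (-t) * |v (-1) 0 2| := by
        rw [mul_assoc, mul_comm (|V (t + t₀ / 2) x 2|)]
        exact mul_le_mul_of_nonneg_left hd hsq_t
      linarith
    have hpos : 0 ≤ (|v (-1) 0 2| - η') * Real.sqrt (-(t + t₀ / 2)) := mul_nonneg (by linarith) hsq_s.le
    have key2 := mul_self_lt_mul_self hpos key
    have e1 : Real.sqrt (-(t + t₀ / 2)) * Real.sqrt (-(t + t₀ / 2)) = -(t + t₀ / 2) := Real.mul_self_sqrt (by linarith)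
    have e2 : Real.sqrt (-t) * Real.sqrt (-t) = -t := Real.mul_self_sqrt (by linarith)
    have key3 : (|v (-1) 0 2| - η') ^ 2 * (-(t + t₀ / 2)) < |v (-1) 0 2| ^ 2 * (-t) := by
      have e3 : (|v (-1) 0 2| - η') * Real.sqrt (-(t + t₀ / 2)) * ((|v (-1) 0 2| - η') * Real.sqrt (-(t + t₀ / 2))) =
          (|v (-1) 0 2| - η') ^ 2 * (Real.sqrt (-(t + t₀ / 2)) * Real.sqrt (-(t + t₀ / 2))) := by ring
      have e4 : |v (-1) 0 2| * Real.sqrt (-t) * (|v (-1) 0 2| * Real.sqrt (-t)) =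
          |v (-1) 0 2| ^ 2 * (Real.sqrt (-t) * Real.sqrt (-t)) := by ring
      rw [e3, e4, e1, e2] at key2
      exact key2
    -- `|N|²(-s₁) < (2|N|η' - η'²)(-(t+s₁)) ≤ 2|N|η'(-(t+s₁))` and `2η'(-T) ≤ |N|(-s₁)`
    have hX : 0 < -(t + t₀ / 2) := by linarith
    have k4 : |v (-1) 0 2| ^ 2 * (-(t₀ / 2)) < 2 * |v (-1) 0 2| * η' * (-(t + t₀ / 2)) := by
      nlinarith [key3, mul_nonneg (sq_nonneg η') hX.le]
    have hT' : η' * (2 * (-T)) ≤ |v (-1) 0 2| * (-(t₀ / 2)) := (le_div_iff₀ (by linarith)).1 hη'T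
    have k5 : 2 * |v (-1) 0 2| * η' * (-T) ≤ |v (-1) 0 2| ^ 2 * (-(t₀ / 2)) := by nlinarith [hT', hm0]
    have k6 : 2 * |v (-1) 0 2| * η' * (-T) < 2 * |v (-1) 0 2| * η' * (-(t + t₀ / 2)) := lt_of_le_of_lt k5 k4
    have hmη : 0 < 2 * |v (-1) 0 2| * η' := mul_pos (mul_pos two_pos hm0) hη'0
    have k7 : -T < -(t + t₀ / 2) := lt_of_mul_lt_mul_left k6 hmη.le
    linarith
  · have h2 : Real.sqrt (-t) ≤ Real.sqrt (-(t + t₀ / 2)) := Real.sqrt_le_sqrt (by linarith)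
    calc |v (-1) 0 2| - η ≤ |v (-1) 0 2| - η' := by linarith
      _ < Real.sqrt (-t) * |V (t + t₀ / 2) x 2| := hx'
      _ ≤ Real.sqrt (-(t + t₀ / 2)) * |V (t + t₀ / 2) x 2| := mul_le_mul_of_nonneg_right h2 (abs_nonneg _)

/-- **PAST PIN for the profile itself**: a pinned peakless profile obeying NO-PIN-LOSS is near-extremal at times `s → −∞` — the pin time `−1` is not the
last, nor the first, near-pin. -/
theorem pastPin_self {C : ℝ} {v : ℝ → EuclideanSpace ℝ (Fin 3) → EuclideanSpace ℝ (Fin 3)} (hP : Pinned C v) (hK : Peakless v) (hNPL : NoPinLoss C v) :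
    ∀ η > 0, ∀ T < 0, ∃ s < T, ∃ x, |v (-1) 0 2| - η < Real.sqrt (-s) * |v s x 2| :=
  pastPin hP.2.2.2.2.2.1 hNPL (class_of_pinned hP) hP.2.2.2.2.1 hK hP.2.2.2.2.2.2.1 (fun hz => pinned_absurd_of_zero hP hz)

/-! ## §12 ETERNAL PIN IN SCALE WINDOWS (PROVED from U3b + U2b + compactness): every far-past scale window of bounded log-length and bounded aperture
carries a near-pin -/

/-- **EternalCore ε₀ R₀ T₀ U** — VERBATIM LINE 23 `eternal_core`: every backward scale window `[4t₀, t₀]`, `t₀ < T₀`, carries a point of the paraboloid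
`‖y‖ ≤ R₀√(−r)` where the scale-covariant speed is at least `ε₀`. -/
def EternalCore (ε₀ R₀ T₀ : ℝ) (U : ℝ → EuclideanSpace ℝ (Fin 3) → EuclideanSpace ℝ (Fin 3)) : Prop :=
  ∀ t₀ : ℝ, t₀ < T₀ → ∃ r ∈ Set.Icc (4 * t₀) t₀, ∃ y : EuclideanSpace ℝ (Fin 3),
    ‖y‖ ≤ R₀ * Real.sqrt (-r) ∧ ε₀ ≤ Real.sqrt (-r) * ‖U r y‖

/-- **U2b `ParaboloidGap`** — VERBATIM LINE 23 `eternal_core` (LANDED: p707892 `…EternalCoreParaboloidGap.paraboloidGap`, ns-es-p1 g8). -/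
def ParaboloidGap : Prop :=
  ∀ C : ℝ, ∃ ε₁ : ℝ, 0 < ε₁ ∧ ∀ ε : ℝ, 0 < ε → ε ≤ ε₁ → ∃ R₁ : ℝ, 0 < R₁ ∧ ∀ R : ℝ, R₁ ≤ R →
    ∀ (U : ℝ → EuclideanSpace ℝ (Fin 3) → EuclideanSpace ℝ (Fin 3)), IsTypeIAncientMild C U → ∀ t₀ : ℝ, t₀ < 0 →
      (∀ r ∈ Set.Icc (4 * t₀) t₀, ∀ y : EuclideanSpace ℝ (Fin 3), ‖y‖ ≤ R * Real.sqrt (-r) → Real.sqrt (-r) * ‖U r y‖ ≤ ε) →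
      ∀ s : ℝ, t₀ ≤ s → s < 0 → ∀ x : EuclideanSpace ℝ (Fin 3), ‖x‖ ≤ R / 4 * Real.sqrt (-s) →
        Real.sqrt (-s) * ‖U s x‖ ≤ 2 * ε

/-- U2b BY NAME (LANDED p707892). -/
theorem paraboloidGap : ParaboloidGap :=
  Summit.NavierStokesRegularity.NavierStokesRegularity.Theorems.PoloidalWindowDoorPoloidalWindowRigidityEternalCoreParaboloidGap.paraboloidGap

/-- `|N| ≤ ‖U(−1,0)‖` — VERBATIM LINE 23. -/
theorem absN_le_norm (U : ℝ → EuclideanSpace ℝ (Fin 3) → EuclideanSpace ℝ (Fin 3)) : |U (-1) 0 2| ≤ ‖U (-1) 0‖ := by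
  have h := EuclideanSpace.norm_eq (U (-1) 0)
  have h2 : |U (-1) 0 2| ^ 2 ≤ ∑ i, |U (-1) 0 i| ^ 2 :=
    Finset.single_le_sum (f := fun i => |U (-1) 0 i| ^ 2) (fun i _ => by positivity) (Finset.mem_univ (2 : Fin 3))
  rw [h]
  have h4 : Real.sqrt (|U (-1) 0 2| ^ 2) = |U (-1) 0 2| := Real.sqrt_sq (abs_nonneg _)
  calc |U (-1) 0 2| = Real.sqrt (|U (-1) 0 2| ^ 2) := h4.symm
    _ ≤ Real.sqrt (∑ i, |U (-1) 0 i| ^ 2) := Real.sqrt_le_sqrt h2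
    _ = Real.sqrt (∑ i, ‖U (-1) 0 i‖ ^ 2) := by simp [Real.norm_eq_abs]

/-- **The pin refuses a small parabolic window** — VERBATIM LINE 23 (PROVED from U2b). -/
theorem notSmallWindow_of_pinned (hG : ParaboloidGap) {C : ℝ} {U : ℝ → EuclideanSpace ℝ (Fin 3) → EuclideanSpace ℝ (Fin 3)} (hP : Pinned C U) :
    ∃ ε₀ : ℝ, 0 < ε₀ ∧ ∃ R₀ : ℝ, 0 < R₀ ∧ ∀ t₀ : ℝ, t₀ ≤ -1 →
      ¬ (∀ r ∈ Set.Icc (4 * t₀) t₀, ∀ y : EuclideanSpace ℝ (Fin 3), ‖y‖ ≤ R₀ * Real.sqrt (-r) → Real.sqrt (-r) * ‖U r y‖ ≤ ε₀) := by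
  obtain ⟨ε₁, hε₁, hg⟩ := hG C
  have hN : U (-1) 0 2 ≠ 0 := hP.2.2.2.2.2.1
  have ha : 0 < |U (-1) 0 2| := abs_pos.2 hN
  set ε : ℝ := min ε₁ (|U (-1) 0 2| / 4) with hεdef
  have hε : 0 < ε := lt_min hε₁ (by positivity)
  have hεle : ε ≤ ε₁ := min_le_left _ _
  have hεa : ε ≤ |U (-1) 0 2| / 4 := min_le_right _ _
  obtain ⟨R₁, hR₁, hR⟩ := hg ε hε hεle
  refine ⟨ε, hε, R₁, hR₁, fun t₀ ht₀ hsmall => ?_⟩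
  have ht₀' : t₀ < 0 := by linarith
  have h := hR R₁ le_rfl U (class_of_pinned hP) t₀ ht₀' hsmall (-1) ht₀ (by norm_num) 0
    (by rw [norm_zero]; positivity)
  have h1 : Real.sqrt (-(-1 : ℝ)) = 1 := by norm_num
  rw [h1, one_mul] at h
  have h2 := absN_le_norm U
  linarith

/-- **U2 `eternalCore_of_pinned`** — VERBATIM LINE 23 (PROVED from U2b): a pinned profile has an ETERNAL CORE. -/
theorem eternalCore_of_pinned (hG : ParaboloidGap) {C : ℝ} {U : ℝ → EuclideanSpace ℝ (Fin 3) → EuclideanSpace ℝ (Fin 3)} (hP : Pinned C U) :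
    ∃ ε₀ : ℝ, 0 < ε₀ ∧ ∃ R₀ : ℝ, 0 < R₀ ∧ EternalCore ε₀ R₀ (-1) U := by
  obtain ⟨ε₀, hε₀, R₀, hR₀, hwin⟩ := notSmallWindow_of_pinned hG hP
  refine ⟨ε₀, hε₀, R₀, hR₀, fun t₀ ht₀ => ?_⟩
  by_contra hcon
  push Not at hcon
  exact hwin t₀ ht₀.le fun r hr y hy => (hcon r hr y hy).le

/-- **ScaleWindowPin v** — ETERNAL PIN IN SCALE WINDOWS (critic W1's «eternal pin», sup sense, located): for every defect `η > 0` there is `Λ ≥ 1` such that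
EVERY backward scale window `[Λt₀, t₀]` (`t₀ ≤ −1`) contains a point of bounded aperture `‖x‖ ≤ Λ√(−t)` where the scale-invariant vertical speed exceeds
`|N| − η`. -/
def ScaleWindowPin (v : ℝ → EuclideanSpace ℝ (Fin 3) → EuclideanSpace ℝ (Fin 3)) : Prop :=
  ∀ η : ℝ, 0 < η → ∃ Λ : ℝ, 1 ≤ Λ ∧ ∀ t₀ : ℝ, t₀ ≤ -1 →
    ∃ t ∈ Set.Icc (Λ * t₀) t₀, ∃ x : EuclideanSpace ℝ (Fin 3),
      ‖x‖ ≤ Λ * Real.sqrt (-t) ∧ |v (-1) 0 2| - η < Real.sqrt (-t) * |v t x 2|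

/-- **ETERNAL PIN IN SCALE WINDOWS (PROVED from U3b, U2b and compactness).**  See the module docstring: failing windows with `Λₙ = n + 1` are rescaled to end at
`−1`; a KNSS limit of the rescaled profiles is admissible and non-zero (eternal core, scale-covariant, passes to the limit by K2-p2 g14's
`eternalCore_of_limit`) and `η`-pin-free on `{t ≤ −1}`, contradicting PAST PIN with `T = −1`. -/
theorem scaleWindowPin_of_noPinLoss {C : ℝ} {v : ℝ → EuclideanSpace ℝ (Fin 3) → EuclideanSpace ℝ (Fin 3)} (hP : Pinned C v) (hK : Peakless v)
    (hNPL : NoPinLoss C v) : ScaleWindowPin v := by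
  intro η hη
  by_contra hcon
  push Not at hcon
  have hN : v (-1) 0 2 ≠ 0 := hP.2.2.2.2.2.1
  have hcl : IsTypeIAncientMild C v := class_of_pinned hP
  -- failing windows with `Λ = n + 1`
  have hΛ : ∀ n : ℕ, (1 : ℝ) ≤ (n : ℝ) + 1 := fun n => by have := n.cast_nonneg (α := ℝ); linarith
  choose t₀ ht₀ hfree using fun n : ℕ => hcon ((n : ℝ) + 1) (hΛ n)
  -- rescale the window top to `−1`: `c n := √(−t₀ n) ≥ 1`, `vs n := nsRescale (c n) v`
  have hc0 : ∀ n, 0 < Real.sqrt (-t₀ n) := fun n => Real.sqrt_pos.2 (by linarith [ht₀ n])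
  have hc1 : ∀ n, 1 ≤ Real.sqrt (-t₀ n) := fun n => by
    rw [show (1 : ℝ) = Real.sqrt 1 from Real.sqrt_one.symm]
    exact Real.sqrt_le_sqrt (by linarith [ht₀ n])
  have hcsq : ∀ n, Real.sqrt (-t₀ n) ^ 2 = -t₀ n := fun n => Real.sq_sqrt (by linarith [ht₀ n])
  set vs : ℕ → ℝ → EuclideanSpace ℝ (Fin 3) → EuclideanSpace ℝ (Fin 3) := fun n => nsRescale (Real.sqrt (-t₀ n)) v with hvs
  have hw : ∀ n, IsTypeIAncientMild C (vs n) := fun n => hcl.nsRescale (hc0 n)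
  -- the rescaled profiles are `η`-pin-free on `t ∈ [−(n+1), −1]`, `‖x‖ ≤ (n+1)√(−t)`
  have hfree' : ∀ n : ℕ, ∀ t : ℝ, -((n : ℝ) + 1) ≤ t → t ≤ -1 → ∀ x : EuclideanSpace ℝ (Fin 3), ‖x‖ ≤ ((n : ℝ) + 1) * Real.sqrt (-t) →
      Real.sqrt (-t) * |vs n t x 2| ≤ |v (-1) 0 2| - η := by
    intro n t ht1 ht2 x hx
    have hmem : Real.sqrt (-t₀ n) ^ 2 * t ∈ Set.Icc (((n : ℝ) + 1) * t₀ n) (t₀ n) := by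
      rw [hcsq, Set.mem_Icc]
      have h1 : 0 ≤ (t + ((n : ℝ) + 1)) * (-t₀ n) := mul_nonneg (by linarith) (by linarith [ht₀ n])
      have h2 : 0 ≤ (-1 - t) * (-t₀ n) := mul_nonneg (by linarith) (by linarith [ht₀ n])
      constructor <;> nlinarith [h1, h2]
    have hxs : ‖Real.sqrt (-t₀ n) • x‖ ≤ ((n : ℝ) + 1) * Real.sqrt (-(Real.sqrt (-t₀ n) ^ 2 * t)) := by
      rw [PoloidalWindowDoorPoloidalWindowRigidityEternalCoreScalingCore.sqrt_neg_sq_mul (hc0 n).le, norm_smul, Real.norm_eq_abs,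
        abs_of_pos (hc0 n)]
      calc Real.sqrt (-t₀ n) * ‖x‖ ≤ Real.sqrt (-t₀ n) * (((n : ℝ) + 1) * Real.sqrt (-t)) := mul_le_mul_of_nonneg_left hx (hc0 n).le
        _ = ((n : ℝ) + 1) * (Real.sqrt (-t₀ n) * Real.sqrt (-t)) := by ring
    have key := hfree n (Real.sqrt (-t₀ n) ^ 2 * t) hmem (Real.sqrt (-t₀ n) • x) hxs
    rw [PoloidalWindowDoorPoloidalWindowRigidityEternalCoreScalingCore.sqrt_neg_sq_mul (hc0 n).le] at key
    have e : Real.sqrt (-t) * |vs n t x 2| = Real.sqrt (-t₀ n) * Real.sqrt (-t) * |v (Real.sqrt (-t₀ n) ^ 2 * t) (Real.sqrt (-t₀ n) • x) 2| := by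
      simp only [hvs, nsRescale_apply, PiLp.smul_apply, smul_eq_mul, abs_mul, abs_of_pos (hc0 n)]
      ring
    rw [e]
    exact key
  -- a KNSS limit of the rescaled profiles
  obtain ⟨φ, hφ, V, hV, hpt, hfd, htlu, -⟩ := exists_tendsto_of_isTypeIAncientMild_seq C hw
  have hpolv : ∀ s < 0, ∀ y, ⟪curl (v s) y, EuclideanSpace.single 2 1⟫_ℝ = 0 := hP.2.2.2.2.1
  have hpolV : ∀ s < 0, ∀ y, ⟪curl (V s) y, EuclideanSpace.single 2 1⟫_ℝ = 0 :=
    fun s hs y => PoloidalWindowDoorPoloidalWindowRigidityPoloidalExtremal.poloidal_of_tendsto (hfd s hs y)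
      (fun j => PoloidalWindowDoorPoloidalWindowRigidityPoloidalExtremal.poloidal_nsRescale hpolv (hc0 (φ j)) s hs y)
  have hKV : Peakless V :=
    PoloidalWindowDoorPoloidalWindowRigidityHotHullCompactness.peaklessClosed (fun j => vs (φ j)) V
      (fun j => PoloidalWindowDoorPoloidalWindowRigidityLeastPinNoPinLoss.peakless_nsRescale hK (hc0 (φ j)))
      (fun j t ht => ((hw (φ j)).contDiff_slice ht).continuous) (fun t ht => (hV.contDiff_slice ht).continuous) (fun t ht => htlu t ht)
  have hc2 : Continuous fun x : EuclideanSpace ℝ (Fin 3) => x 2 := by fun_prop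
  have hval : ∀ t < 0, ∀ x, Tendsto (fun j => vs (φ j) t x 2) atTop (𝓝 (V t x 2)) :=
    fun t ht x => (hc2.tendsto _).comp (hpt t ht x)
  have hdomV : ∀ t < 0, ∀ x, Real.sqrt (-t) * |V t x 2| ≤ |v (-1) 0 2| := fun t ht x =>
    le_of_tendsto (((continuous_const.mul continuous_abs).tendsto _).comp (hval t ht x))
      (Eventually.of_forall fun j =>
        PoloidalWindowDoorPoloidalWindowRigidityEternalCoreScalingCore.extremal_nsRescale hP.2.2.2.2.2.2.1 (hc0 (φ j)) t ht x)
  -- the limit is NON-ZERO: the eternal core is scale-covariant and passes to the limit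
  obtain ⟨ε₀, hε₀, R₀, hR₀, hcore⟩ := eternalCore_of_pinned paraboloidGap hP
  have hcoreV := PoloidalWindowDoorPoloidalWindowRigidityEternalCoreScalingCore.eternalCore_of_limit C ε₀ R₀ (-1) (by norm_num)
    (fun j => hw (φ j)) hV hpt
    (fun t₁ ht₁ => Eventually.of_forall fun j =>
      PoloidalWindowDoorPoloidalWindowRigidityEternalCoreScalingCore.eternalCore_nsRescale hcore (hc0 (φ j)) t₁
        (by
          have h1 : 0 ≤ (Real.sqrt (-t₀ (φ j)) ^ 2 - 1) * (-1 - t₁) :=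
            mul_nonneg (by nlinarith [hc1 (φ j)]) (by linarith)
          nlinarith [h1, hc1 (φ j)]))
  have hnzV : ¬ ∀ t < 0, ∀ x, V t x = 0 := by
    intro h0
    obtain ⟨r, hr, y, -, hε⟩ := hcoreV (-2) (by norm_num)
    have hr0 : r < 0 := by linarith [hr.2]
    rw [h0 r hr0 y, norm_zero, mul_zero] at hε
    linarith
  -- the limit is `η`-pin-free on `{t ≤ −1}`
  have hfreeV : ∀ t : ℝ, t ≤ -1 → ∀ x : EuclideanSpace ℝ (Fin 3), Real.sqrt (-t) * |V t x 2| ≤ |v (-1) 0 2| - η := by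
    intro t ht x
    have ht0 : t < 0 := by linarith
    have hsq0 : 0 < Real.sqrt (-t) := Real.sqrt_pos.2 (by linarith)
    refine le_of_tendsto (((continuous_const.mul continuous_abs).tendsto _).comp (hval t ht0 x)) ?_
    obtain ⟨N₀, hN₀⟩ := exists_nat_ge (max (-t) (‖x‖ / Real.sqrt (-t)))
    refine eventually_atTop.2 ⟨N₀, fun j hj => ?_⟩
    have hφj : (N₀ : ℝ) ≤ (φ j : ℝ) := by exact_mod_cast hj.trans (hφ.id_le j)
    refine hfree' (φ j) t ?_ ht x ?_
    · linarith [le_max_left (-t) (‖x‖ / Real.sqrt (-t))]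
    · have h1 : ‖x‖ / Real.sqrt (-t) ≤ (φ j : ℝ) + 1 := by linarith [le_max_right (-t) (‖x‖ / Real.sqrt (-t))]
      rwa [div_le_iff₀ hsq0] at h1
  -- PAST PIN for the limit with `T = −1` is the contradiction
  obtain ⟨s, hs, x, hx⟩ := pastPin hN hNPL hV hpolV hKV hdomV hnzV η hη (-1) (by norm_num)
  have := hfreeV s hs.le x
  linarith

/-- **NEAR-PINNED BLOW-DOWNS (PROVED; census B-g8-3 inverted up to `η`).**  In blow-down language: for every `η > 0` there is `Λ ≥ 1` such that every scale
window `[Λt₀, t₀]`, `t₀ ≤ −1`, contains a time `t` whose blow-down `nsRescale √(−t) v` (the profile seen at scale `√(−t)` from the blow-up point) carries an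
`η`-near-pin AT TIME `−1` INSIDE THE BALL `‖y‖ ≤ Λ`. -/
theorem nearPinnedBlowDowns {C : ℝ} {v : ℝ → EuclideanSpace ℝ (Fin 3) → EuclideanSpace ℝ (Fin 3)} (hP : Pinned C v) (hK : Peakless v)
    (hNPL : NoPinLoss C v) :
    ∀ η : ℝ, 0 < η → ∃ Λ : ℝ, 1 ≤ Λ ∧ ∀ t₀ : ℝ, t₀ ≤ -1 → ∃ t ∈ Set.Icc (Λ * t₀) t₀, ∃ y : EuclideanSpace ℝ (Fin 3),
      ‖y‖ ≤ Λ ∧ |v (-1) 0 2| - η < |nsRescale (Real.sqrt (-t)) v (-1) y 2| := by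
  intro η hη
  obtain ⟨Λ, hΛ, hwin⟩ := scaleWindowPin_of_noPinLoss hP hK hNPL η hη
  refine ⟨Λ, hΛ, fun t₀ ht₀ => ?_⟩
  obtain ⟨t, ht, x, hx, hpin⟩ := hwin t₀ ht₀
  have ht1 : t ≤ -1 := ht.2.trans ht₀
  have hc : 0 < Real.sqrt (-t) := Real.sqrt_pos.2 (by linarith)
  refine ⟨t, ht, (Real.sqrt (-t))⁻¹ • x, ?_, ?_⟩
  · rw [norm_smul, norm_inv, Real.norm_eq_abs, abs_of_pos hc, inv_mul_le_iff₀ hc, mul_comm]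
    exact hx
  · have h2 : Real.sqrt (-t) ^ 2 * (-1) = t := by rw [Real.sq_sqrt (by linarith)]; ring
    have h3 : Real.sqrt (-t) • ((Real.sqrt (-t))⁻¹ • x) = x := by rw [smul_smul, mul_inv_cancel₀ hc.ne', one_smul]
    rw [nsRescale_apply, h3, h2, PiLp.smul_apply, smul_eq_mul, abs_mul, abs_of_pos hc]
    exact hpin

/-- **NEAR-PINNED BLOW-DOWN LIMITS EXIST (PROVED).**  For every `η > 0` the blow-down hull of a least-pin profile obeying NO-PIN-LOSS contains an ADMISSIBLE profile
`V` (class `C`, e₂-poloidal, peakless, dominated by `|N|`) — a slice-wise limit of blow-downs `nsRescale cⱼ v`, `cⱼ → ∞` — with an `η`-near-pin AT TIME `−1` inside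
the ball `‖y‖ ≤ Λ(η)`: the object on which the scaling dynamics of the column (LINE 23 U2d, hot_hull RECURRENT-LEAF) acts. -/
theorem nearPinnedBlowDownLimit {C : ℝ} {v : ℝ → EuclideanSpace ℝ (Fin 3) → EuclideanSpace ℝ (Fin 3)} (hP : Pinned C v) (hK : Peakless v)
    (hNPL : NoPinLoss C v) :
    ∀ η : ℝ, 0 < η → ∃ Λ : ℝ, 1 ≤ Λ ∧ ∃ V : ℝ → EuclideanSpace ℝ (Fin 3) → EuclideanSpace ℝ (Fin 3),
      IsTypeIAncientMild C V ∧ (∀ s < 0, ∀ y, ⟪curl (V s) y, EuclideanSpace.single 2 1⟫_ℝ = 0) ∧ Peakless V ∧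
      (∀ t < 0, ∀ x, Real.sqrt (-t) * |V t x 2| ≤ |v (-1) 0 2|) ∧
      (∃ y : EuclideanSpace ℝ (Fin 3), ‖y‖ ≤ Λ ∧ |v (-1) 0 2| - η ≤ |V (-1) y 2|) ∧
      ∃ c : ℕ → ℝ, (∀ j, 1 ≤ c j) ∧ Tendsto c atTop atTop ∧ ∀ t < 0, ∀ x, Tendsto (fun j => nsRescale (c j) v t x) atTop (𝓝 (V t x)) := by
  intro η hη
  obtain ⟨Λ, hΛ, hwin⟩ := nearPinnedBlowDowns hP hK hNPL η hη
  refine ⟨Λ, hΛ, ?_⟩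
  have hcl : IsTypeIAncientMild C v := class_of_pinned hP
  choose t ht y hy hpin using fun n : ℕ => hwin (-((n : ℝ) + 1)) (by linarith [n.cast_nonneg (α := ℝ)])
  -- Bolzano–Weierstrass for the near-pin positions
  obtain ⟨yb, hybmem, ψ, hψ, hyψ⟩ := tendsto_subseq_of_bounded (Metric.isBounded_closedBall (x := (0 : EuclideanSpace ℝ (Fin 3))) (r := Λ))
    (x := y) (fun n => mem_closedBall_zero_iff.2 (hy n))
  have hybnorm : ‖yb‖ ≤ Λ := by
    rw [Metric.isClosed_closedBall.closure_eq] at hybmem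
    exact mem_closedBall_zero_iff.1 hybmem
  -- the blow-downs at the window times
  have ht1 : ∀ n, t (ψ n) ≤ -1 := fun n => (ht (ψ n)).2.trans (by linarith [(ψ n).cast_nonneg (α := ℝ)])
  have htn : ∀ n : ℕ, (n : ℝ) + 1 ≤ -t (ψ n) := fun n => by
    have h1 := (ht (ψ n)).2
    have h2 : (n : ℝ) ≤ (ψ n : ℝ) := by exact_mod_cast hψ.id_le n
    linarith
  set c : ℕ → ℝ := fun n => Real.sqrt (-t (ψ n)) with hc
  have hc0 : ∀ n, 0 < c n := fun n => Real.sqrt_pos.2 (by linarith [ht1 n])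
  have hc1 : ∀ n, 1 ≤ c n := fun n => by
    rw [show (1 : ℝ) = Real.sqrt 1 from Real.sqrt_one.symm]
    exact Real.sqrt_le_sqrt (by linarith [ht1 n])
  have hcTop : Tendsto c atTop atTop := by
    have h1 : Tendsto (fun n : ℕ => Real.sqrt ((n : ℝ) + 1)) atTop atTop :=
      Real.tendsto_sqrt_atTop.comp (tendsto_atTop_add_const_right _ 1 tendsto_natCast_atTop_atTop)
    exact tendsto_atTop_mono (fun n => Real.sqrt_le_sqrt (htn n)) h1
  set w : ℕ → ℝ → EuclideanSpace ℝ (Fin 3) → EuclideanSpace ℝ (Fin 3) := fun n => nsRescale (c n) v with hw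
  have hwc : ∀ n, IsTypeIAncientMild C (w n) := fun n => hcl.nsRescale (hc0 n)
  obtain ⟨φ, hφ, V, hV, hpt, hfd, htlu, -⟩ := exists_tendsto_of_isTypeIAncientMild_seq C hwc
  have hpolv : ∀ s < 0, ∀ y, ⟪curl (v s) y, EuclideanSpace.single 2 1⟫_ℝ = 0 := hP.2.2.2.2.1
  have hpolV : ∀ s < 0, ∀ y, ⟪curl (V s) y, EuclideanSpace.single 2 1⟫_ℝ = 0 :=
    fun s hs y => PoloidalWindowDoorPoloidalWindowRigidityPoloidalExtremal.poloidal_of_tendsto (hfd s hs y)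
      (fun j => PoloidalWindowDoorPoloidalWindowRigidityPoloidalExtremal.poloidal_nsRescale hpolv (hc0 (φ j)) s hs y)
  have hKV : Peakless V :=
    PoloidalWindowDoorPoloidalWindowRigidityHotHullCompactness.peaklessClosed (fun j => w (φ j)) V
      (fun j => PoloidalWindowDoorPoloidalWindowRigidityLeastPinNoPinLoss.peakless_nsRescale hK (hc0 (φ j)))
      (fun j t ht => ((hwc (φ j)).contDiff_slice ht).continuous) (fun t ht => (hV.contDiff_slice ht).continuous) (fun t ht => htlu t ht)
  have hc2 : Continuous fun x : EuclideanSpace ℝ (Fin 3) => x 2 := by fun_prop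
  have hdomV : ∀ t < 0, ∀ x, Real.sqrt (-t) * |V t x 2| ≤ |v (-1) 0 2| := fun t ht x =>
    le_of_tendsto (((continuous_const.mul continuous_abs).tendsto _).comp ((hc2.tendsto _).comp (hpt t ht x)))
      (Eventually.of_forall fun j =>
        PoloidalWindowDoorPoloidalWindowRigidityEternalCoreScalingCore.extremal_nsRescale hP.2.2.2.2.2.2.1 (hc0 (φ j)) t ht x)
  -- the near-pin passes to the limit along the moving points `y (ψ (φ j)) → yb`
  have hg : Tendsto (fun j => y (ψ (φ j))) atTop (𝓝 yb) := hyψ.comp hφ.tendsto_atTop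
  have hcontV : ContinuousAt (V (-1)) yb := ((hV.contDiff_slice (by norm_num)).continuous).continuousAt
  have hlim : Tendsto (fun j => w (φ j) (-1) (y (ψ (φ j)))) atTop (𝓝 (V (-1) yb)) := (htlu (-1) (by norm_num)).tendsto_comp hcontV hg
  have hlim2 : Tendsto (fun j => |w (φ j) (-1) (y (ψ (φ j))) 2|) atTop (𝓝 |V (-1) yb 2|) :=
    (continuous_abs.tendsto _).comp ((hc2.tendsto _).comp hlim)
  have hpinV : |v (-1) 0 2| - η ≤ |V (-1) yb 2| :=
    ge_of_tendsto hlim2 (Eventually.of_forall fun j => (hpin (ψ (φ j))).le)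
  exact ⟨V, hV, hpolV, hKV, hdomV, ⟨yb, hybnorm, hpinV⟩, fun j => c (φ j), fun j => hc1 (φ j), hcTop.comp hφ.tendsto_atTop,
    fun t ht x => hpt t ht x⟩

/-! ## §13 LINE 25's cell ETERNAL-PIN, VERBATIM (here NOT a sorry: it is DERIVED from the two cells of LINE 26 in §20) -/

/-- **PastPin C v** — the PAST-PIN LAW (PROVED in §11 from `NoPinLoss C v`) as a predicate: every admissible profile dominated by `|N|` is near-extremal in the
arbitrarily far past. -/
def PastPin (C : ℝ) (v : ℝ → EuclideanSpace ℝ (Fin 3) → EuclideanSpace ℝ (Fin 3)) : Prop :=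
  ∀ V : ℝ → EuclideanSpace ℝ (Fin 3) → EuclideanSpace ℝ (Fin 3), IsTypeIAncientMild C V →
    (∀ s < 0, ∀ y, ⟪curl (V s) y, EuclideanSpace.single 2 1⟫_ℝ = 0) → Peakless V →
    (∀ t < 0, ∀ x, Real.sqrt (-t) * |V t x 2| ≤ |v (-1) 0 2|) → (¬ ∀ t < 0, ∀ x, V t x = 0) →
    ∀ η > 0, ∀ T < 0, ∃ s < T, ∃ x, |v (-1) 0 2| - η < Real.sqrt (-s) * |V s x 2|

/-- **Research cell ETERNAL-PIN (OPEN).**  Kill a pinned, thick, peakless class-`C` LEAST-PIN profile obeying NO-PIN-LOSS, the PAST-PIN LAW over its admissible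
class, and ETERNALLY PINNED IN SCALE WINDOWS with bounded aperture.  (All binders after `LeastPin` are THEOREMS for least-pin profiles — the kernel below derives
them; the cell states them so that the research prover has them as data.) -/
def CellEternalPin : Prop :=
  AnisotropicGap →
  ∀ (C : ℝ) (v : ℝ → EuclideanSpace ℝ (Fin 3) → EuclideanSpace ℝ (Fin 3)) (W : Set (ℝ × EuclideanSpace ℝ (Fin 3))),
    Pinned C v → ThickWindow v W → Peakless v → LeastPin C v → NoPinLoss C v → PastPin C v → ScaleWindowPin v → False

/-- **Kernel (PROVED): cell ETERNAL-PIN ⇒ cell LEAST-PIN** — the two extra binders are theorems (`pastPin`, `scaleWindowPin_of_noPinLoss`). -/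
theorem cellLeastPin_of_eternalPin (hcell : CellEternalPin) : CellLeastPin := by
  intro hAG C v W hP hW hK hL hNPL
  exact hcell hAG C v W hP hW hK hL hNPL
    (fun V hV hpol hKV hdom hnz => pastPin hP.2.2.2.2.2.1 hNPL hV hpol hKV hdom hnz)
    (scaleWindowPin_of_noPinLoss hP hK hNPL)

/-- **HL3′ ⇐ THGerm ∧ ETERNAL-PIN** (U3a, U3b discharged BY NAME). -/
theorem hl3_of_eternalPin (hTH : THGerm) (hcell : CellEternalPin) : HL3' :=
  hl3_of_stubs hTH (cellLeastPin_of_eternalPin hcell)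

/-! ## §14 Compositions to the crux items BY NAME (CONDITIONAL on S0, the wall ⟨27893⟩ and the cell ETERNAL-PIN; no summit, no crux is proved) -/

/-- **The crux `PoloidalWindowRigidity` (K2, stmt-NavierStokesRegularity-19708) BY NAME ⇐ S0 ∧ ⟨27893⟩ ∧ ETERNAL-PIN.**  CONDITIONAL. -/
theorem PoloidalWindowRigidity_of_eternalPin (hS0 : S0Statement)
    (hG : Summit.NavierStokesRegularity.NavierStokesRegularity.Theses.LoopPeriodRatchet.FrequencyGrowthExponent) (hcell : CellEternalPin) :
    Summit.NavierStokesRegularity.NavierStokesRegularity.Theses.PoloidalWindowDoor.PoloidalWindowRigidity :=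
  PoloidalWindowRigidity_of_stubs hS0 hG (cellLeastPin_of_eternalPin hcell)

/-- **The item `LrcModEntire` (stmt-NavierStokesRegularity-20428) BY NAME ⇐ S0 ∧ ⟨27893⟩ ∧ ETERNAL-PIN.**  CONDITIONAL. -/
theorem LrcModEntire_of_eternalPin (hS0 : S0Statement)
    (hG : Summit.NavierStokesRegularity.NavierStokesRegularity.Theses.LoopPeriodRatchet.FrequencyGrowthExponent) (hcell : CellEternalPin) :
    Summit.NavierStokesRegularity.NavierStokesRegularity.Theses.PoloidalWindowDoor.LrcModEntire :=
  LrcModEntire_of_stubs hS0 hG (cellLeastPin_of_eternalPin hcell)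

/-! ## §15 LINE 26 `eternal_web` — THE PARABOLOID PIN VALUE of the least-pin critical element and the ETERNAL-WEB / BREATHING DICHOTOMY

For a pinned profile `v` (pin value `|N| = |v₂(−1,0)|`, dominated: `√(−t)|v₂| ≤ |N|` everywhere) and an APERTURE `A > 0` the PARABOLOID PIN VALUE at time
`t < 0` is `M_A(t) := sup {√(−t)|v₂(t,x)| : ‖x‖ ≤ A√(−t)} ≤ |N|` — the scale-invariant vertical speed seen inside the backward paraboloid of aperture `A`.
LINE 25 proved that `M_{Λ(η)}` RETURNS above `|N| − η` in every scale window (`ScaleWindowPin`); census B-g11-3 recorded that NO time-monotonicity of `M_A` is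
known.  LINE 26 types the failure of monotonicity as an object: either `M_A(t) → |N|` as `t → −∞` for SOME aperture (`AsymptoticallyPinned A v`) or, for EVERY
aperture, `M_A` dips below `|N| − η(A)` at arbitrarily ancient times (`Breathing v`) — and proves what each branch hands to the research prover. -/

/-- `|a₂| ≤ ‖a‖` in `ℝ³`. -/
theorem abs_apply_two_le_norm (a : EuclideanSpace ℝ (Fin 3)) : |a 2| ≤ ‖a‖ := by
  have h := EuclideanSpace.norm_eq a
  have h2 : |a 2| ^ 2 ≤ ∑ i, |a i| ^ 2 :=
    Finset.single_le_sum (f := fun i => |a i| ^ 2) (fun i _ => by positivity) (Finset.mem_univ (2 : Fin 3))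
  rw [h]
  calc |a 2| = Real.sqrt (|a 2| ^ 2) := (Real.sqrt_sq (abs_nonneg _)).symm
    _ ≤ Real.sqrt (∑ i, |a i| ^ 2) := Real.sqrt_le_sqrt h2
    _ = Real.sqrt (∑ i, ‖a i‖ ^ 2) := by simp [Real.norm_eq_abs]

/-- `|a₂ − b₂| ≤ dist a b` in `ℝ³`. -/
theorem abs_apply_two_sub_le_dist (a b : EuclideanSpace ℝ (Fin 3)) : |a 2 - b 2| ≤ dist a b := by
  have e : a 2 - b 2 = (a - b) 2 := by simp
  rw [dist_eq_norm, e]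
  exact abs_apply_two_le_norm _

/-- **AsymptoticallyPinned A v** — the paraboloid pin value of aperture `A` tends to the full pin in the far past: for every defect `η > 0`, at EVERY
sufficiently ancient time `t` some point of the paraboloid `‖x‖ ≤ A√(−t)` carries `√(−t)|v₂(t,x)| > |N| − η`. -/
def AsymptoticallyPinned (A : ℝ) (v : ℝ → EuclideanSpace ℝ (Fin 3) → EuclideanSpace ℝ (Fin 3)) : Prop :=
  ∀ η : ℝ, 0 < η → ∃ T : ℝ, T < 0 ∧ ∀ t : ℝ, t < T → ∃ x : EuclideanSpace ℝ (Fin 3),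
    ‖x‖ ≤ A * Real.sqrt (-t) ∧ |v (-1) 0 2| - η < Real.sqrt (-t) * |v t x 2|

/-- **Breathing v** — in EVERY paraboloid the pin value DIPS by a definite amount at arbitrarily ancient times: for every aperture `A > 0` there is a defect
`η = η(A) > 0` and a sequence of times `t ↓ −∞` at which `√(−t)|v₂(t,x)| ≤ |N| − η` on the whole ball `‖x‖ ≤ A√(−t)`.  (Exactly the negation of
`∃ A > 0, AsymptoticallyPinned A v`: `dichotomy`.) -/
def Breathing (v : ℝ → EuclideanSpace ℝ (Fin 3) → EuclideanSpace ℝ (Fin 3)) : Prop :=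
  ∀ A : ℝ, 0 < A → ∃ η : ℝ, 0 < η ∧ ∀ T : ℝ, T < 0 → ∃ t : ℝ, t < T ∧ ∀ x : EuclideanSpace ℝ (Fin 3),
    ‖x‖ ≤ A * Real.sqrt (-t) → Real.sqrt (-t) * |v t x 2| ≤ |v (-1) 0 2| - η

/-- **The dichotomy (PROVED, logic):** every profile is asymptotically pinned in some paraboloid or breathing in every paraboloid. -/
theorem dichotomy (v : ℝ → EuclideanSpace ℝ (Fin 3) → EuclideanSpace ℝ (Fin 3)) :
    (∃ A : ℝ, 0 < A ∧ AsymptoticallyPinned A v) ∨ Breathing v := by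
  by_cases h : ∃ A : ℝ, 0 < A ∧ AsymptoticallyPinned A v
  · exact Or.inl h
  · refine Or.inr fun A hA => ?_
    by_contra hcon
    refine h ⟨A, hA, fun η hη => ?_⟩
    by_contra hcon2
    refine hcon ⟨η, hη, fun T hT => ?_⟩
    by_contra hcon3
    refine hcon2 ⟨T, hT, fun t ht => ?_⟩
    by_contra hcon4
    refine hcon3 ⟨t, ht, fun x hx => ?_⟩
    by_contra hcon5
    exact hcon4 ⟨x, hx, lt_of_not_ge hcon5⟩

/-! ## §16 RE-CENTRED BLOW-DOWNS ARE PINNED (PROVED) and the predicate ETERNALLY PINNED -/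

/-- `Peakless` is invariant under re-centring `V ↦ nsRescale c (V(·, x + ·))` (tree `peakless_translate`, `peakless_nsRescale`). -/
theorem peakless_recentre {V : ℝ → EuclideanSpace ℝ (Fin 3) → EuclideanSpace ℝ (Fin 3)} (hK : Peakless V) {c : ℝ} (hc : 0 < c)
    (x : EuclideanSpace ℝ (Fin 3)) : Peakless (nsRescale c (fun s y => V s (x + y))) := by
  have e : (fun t y => V t (y + x)) = fun t y => V t (x + y) := by
    funext t y; rw [add_comm]
  have h1 := PoloidalWindowDoorPoloidalWindowRigidityHotHullCompactness.peakless_translate hK x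
  rw [e] at h1
  exact PoloidalWindowDoorPoloidalWindowRigidityLeastPinNoPinLoss.peakless_nsRescale h1 hc

/-- **Re-centred blow-downs at full-pin points are PINNED (PROVED).**  If a class-`C` e₂-poloidal profile `V` is dominated by `m > 0`
(`√(−s)|V₂| ≤ m`) and realises `m` at `(t, x)`, then the blow-down at scale `√(−t)` re-centred at `x`, `U := nsRescale √(−t) (V(·, x + ·))`, is `Pinned C`
with pin value `m`: class and poloidality are invariant, domination is scale-invariant (`extremal_nsRescale`), `|U₂(−1,0)| = m`, and the gradient / time /
Laplacian pins follow by Fermat (tree `threadPin_of_hotSpot`, `threadSignedPin`). -/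
theorem pinned_recentre {C m : ℝ} {V : ℝ → EuclideanSpace ℝ (Fin 3) → EuclideanSpace ℝ (Fin 3)} (hV : IsTypeIAncientMild C V)
    (hpol : ∀ s < 0, ∀ y, ⟪curl (V s) y, EuclideanSpace.single 2 1⟫_ℝ = 0)
    (hdom : ∀ s < 0, ∀ y, Real.sqrt (-s) * |V s y 2| ≤ m) (hm : 0 < m) {t : ℝ} (ht : t < 0) {x : EuclideanSpace ℝ (Fin 3)}
    (hval : Real.sqrt (-t) * |V t x 2| = m) :
    Pinned C (nsRescale (Real.sqrt (-t)) (fun s y => V s (x + y))) ∧ |nsRescale (Real.sqrt (-t)) (fun s y => V s (x + y)) (-1) 0 2| = m := by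
  set c : ℝ := Real.sqrt (-t) with hc
  have hc0 : 0 < c := Real.sqrt_pos.2 (neg_pos.2 ht)
  set U : ℝ → EuclideanSpace ℝ (Fin 3) → EuclideanSpace ℝ (Fin 3) := nsRescale c (fun s y => V s (x + y)) with hUdef
  have hU : IsTypeIAncientMild C U := isTypeIAncientMild_nsRescale (isTypeIAncientMild_translate hV x) hc0
  have hrate : HasTypeITimeDecay C U := hU.2.2.2
  have hcont : ContinuousOn (Function.uncurry U) (Set.Iio (0 : ℝ) ×ˢ Set.univ) := hU.1.continuousOn
  have hmild : ∀ s t : ℝ, s < t → t < 0 → ∀ x, U t x =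
      UnboundedOperators.heatExtension (U s) (t - s) x - oseenDuhamel 1 s U U t x :=
    fun s t hst ht x => hU.mild_eq_heatExtension hst ht x
  have hdiv : ∀ t < 0, VectorCalculus.IsDivFree (U t) := hU.2.1
  have hpolU : ∀ s < 0, ∀ y, ⟪curl (U s) y, EuclideanSpace.single 2 1⟫_ℝ = 0 :=
    PoloidalWindowDoorPoloidalWindowRigidityPoloidalExtremal.poloidal_nsRescale
      (PoloidalWindowDoorPoloidalWindowRigidityPoloidalExtremal.poloidal_translate hpol x) hc0
  have hdomT : ∀ s < 0, ∀ y, Real.sqrt (-s) * |(fun s y => V s (x + y)) s y 2| ≤ m := fun s hs y => hdom s hs (x + y)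
  have hdomU : ∀ s < 0, ∀ y, Real.sqrt (-s) * |U s y 2| ≤ m := fun s hs y =>
    PoloidalWindowDoorPoloidalWindowRigidityEternalCoreScalingCore.extremal_nsRescale hdomT hc0 s hs y
  have hval0 : U (-1) 0 2 = c * V t x 2 := by
    have h1 : c ^ 2 * (-1 : ℝ) = t := by rw [hc, Real.sq_sqrt (neg_nonneg.2 ht.le)]; ring
    simp only [hUdef, nsRescale_apply, smul_zero, add_zero, h1, PiLp.smul_apply, smul_eq_mul]
  have habs : |U (-1) 0 2| = m := by rw [hval0, abs_mul, abs_of_pos hc0]; exact hval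
  have hne : U (-1) 0 2 ≠ 0 := by
    intro h0; rw [h0, abs_zero] at habs; exact absurd habs hm.ne
  have hhot : ∀ s < 0, ∀ y, Real.sqrt (-s) * |U s y 2| ≤ |U (-1) 0 2| := fun s hs y => habs ▸ hdomU s hs y
  exact ⟨⟨hrate, hcont, hmild, hdiv, hpolU, hne, hhot,
      PoloidalWindowDoorLrcModEntireThreadPins.threadPin_of_hotSpot hrate hcont hmild hhot,
      PoloidalWindowDoorLrcModEntireThreadPins.threadSignedPin C U hrate hcont hmild hdiv hne hhot⟩, habs⟩

/-- **EternallyPinned A C v** — the pin is REALISED AT EVERY PAST TIME inside the paraboloid of aperture `A`: for every `t ≤ −1` there is `x`,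
`‖x‖ ≤ A√(−t)`, with `√(−t)|v₂(t,x)| = |N|` (so `(t, x)` is a space-time maximum of the scale-invariant vertical speed), and the blow-down at scale `√(−t)`
re-centred there is again a PINNED profile of the column (all nine conjuncts of `Pinned`, pin value `|N|`: `pinned_recentre`).  The hot spot never switches
off: an ETERNAL HOT WEB (`eternalWeb_unbounded`: at each such time the planar hot component through the hot point is unbounded). -/
def EternallyPinned (A C : ℝ) (v : ℝ → EuclideanSpace ℝ (Fin 3) → EuclideanSpace ℝ (Fin 3)) : Prop :=
  ∀ t : ℝ, t ≤ -1 → ∃ x : EuclideanSpace ℝ (Fin 3), ‖x‖ ≤ A * Real.sqrt (-t) ∧ Real.sqrt (-t) * |v t x 2| = |v (-1) 0 2| ∧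
    Pinned C (nsRescale (Real.sqrt (-t)) (fun s y => v s (x + y)))

/-! ## §17 THE ETERNAL-WEB EXTRACTION (PROVED): asymptotically pinned ⇒ a blow-down limit pinned at EVERY past time -/

/-- **ETERNAL-WEB EXTRACTION (PROVED).**  If a pinned peakless profile `v` is asymptotically pinned in the paraboloid of aperture `A`, then its blow-down hull
contains a profile `W` — PINNED (at `(−1,0)`, same pin value `|N|`), PEAKLESS — which is ETERNALLY PINNED with aperture `2A`.  Proof: blow-downs
`nsRescale (n+1) v`; a KNSS limit `V` with gradients (`exists_tendsto_of_isTypeIAncientMild_seq`) is class `C`, poloidal, peakless, dominated by `|N|`; for each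
fixed `t < 0` the blow-downs converge UNIFORMLY on the compact ball `‖y‖ ≤ A√(−t)` (`tendstoLocallyUniformlyOn_iff_tendstoUniformlyOn_of_compact`), and the
asymptotic pins of `v` at the physical times `(n+1)²t → −∞` pull back into that ball, so the maximum of `√(−t)|V₂(t,·)|` over the ball (attained, compactness)
is `≥ |N| − 2η` for every `η`, hence `= |N|`; re-centre at the time-`(−1)` maximiser (`pinned_recentre`, `nsRescale_one`); at `t ≤ −1` the maximiser `x(t)`
has `‖x(t) − x(−1)‖ ≤ A√(−t) + A ≤ 2A√(−t)`. -/
theorem eternalWebExtraction {C A : ℝ} {v : ℝ → EuclideanSpace ℝ (Fin 3) → EuclideanSpace ℝ (Fin 3)} (hP : Pinned C v) (hK : Peakless v)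
    (hA : 0 < A) (hAP : AsymptoticallyPinned A v) :
    ∃ W : ℝ → EuclideanSpace ℝ (Fin 3) → EuclideanSpace ℝ (Fin 3),
      Pinned C W ∧ Peakless W ∧ |W (-1) 0 2| = |v (-1) 0 2| ∧ EternallyPinned (2 * A) C W := by
  have hcl : IsTypeIAncientMild C v := class_of_pinned hP
  have hN : v (-1) 0 2 ≠ 0 := hP.2.2.2.2.2.1
  have hm0 : 0 < |v (-1) 0 2| := abs_pos.2 hN
  have hpolv : ∀ s < 0, ∀ y, ⟪curl (v s) y, EuclideanSpace.single 2 1⟫_ℝ = 0 := hP.2.2.2.2.1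
  have hdomv : ∀ t < 0, ∀ x, Real.sqrt (-t) * |v t x 2| ≤ |v (-1) 0 2| := hP.2.2.2.2.2.2.1
  -- blow-downs along `c n = n + 1 → ∞`
  set c : ℕ → ℝ := fun n => (n : ℝ) + 1 with hc
  have hc0 : ∀ n, 0 < c n := fun n => by simp only [hc]; positivity
  have hcTop : Tendsto c atTop atTop := tendsto_atTop_add_const_right _ 1 tendsto_natCast_atTop_atTop
  set w : ℕ → ℝ → EuclideanSpace ℝ (Fin 3) → EuclideanSpace ℝ (Fin 3) := fun n => nsRescale (c n) v with hw
  have hwc : ∀ n, IsTypeIAncientMild C (w n) := fun n => hcl.nsRescale (hc0 n)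
  obtain ⟨φ, hφ, V, hV, hpt, hfd, htlu, -⟩ := exists_tendsto_of_isTypeIAncientMild_seq C hwc
  have hpolV : ∀ s < 0, ∀ y, ⟪curl (V s) y, EuclideanSpace.single 2 1⟫_ℝ = 0 :=
    fun s hs y => PoloidalWindowDoorPoloidalWindowRigidityPoloidalExtremal.poloidal_of_tendsto (hfd s hs y)
      (fun j => PoloidalWindowDoorPoloidalWindowRigidityPoloidalExtremal.poloidal_nsRescale hpolv (hc0 (φ j)) s hs y)
  have hKV : Peakless V :=
    PoloidalWindowDoorPoloidalWindowRigidityHotHullCompactness.peaklessClosed (fun j => w (φ j)) V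
      (fun j => PoloidalWindowDoorPoloidalWindowRigidityLeastPinNoPinLoss.peakless_nsRescale hK (hc0 (φ j)))
      (fun j t ht => ((hwc (φ j)).contDiff_slice ht).continuous) (fun t ht => (hV.contDiff_slice ht).continuous) (fun t ht => htlu t ht)
  have hc2 : Continuous fun x : EuclideanSpace ℝ (Fin 3) => x 2 := by fun_prop
  have hdomV : ∀ t < 0, ∀ x, Real.sqrt (-t) * |V t x 2| ≤ |v (-1) 0 2| := fun t ht x =>
    le_of_tendsto (((continuous_const.mul continuous_abs).tendsto _).comp ((hc2.tendsto _).comp (hpt t ht x)))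
      (Eventually.of_forall fun j =>
        PoloidalWindowDoorPoloidalWindowRigidityEternalCoreScalingCore.extremal_nsRescale hdomv (hc0 (φ j)) t ht x)
  -- KEY: at every time `t < 0` the full pin `|N|` is realised inside the ball `‖y‖ ≤ A√(−t)`
  have hkey : ∀ t < 0, ∃ x : EuclideanSpace ℝ (Fin 3), ‖x‖ ≤ A * Real.sqrt (-t) ∧ Real.sqrt (-t) * |V t x 2| = |v (-1) 0 2| := by
    intro t ht
    have hst : 0 < Real.sqrt (-t) := Real.sqrt_pos.2 (neg_pos.2 ht)
    set K : Set (EuclideanSpace ℝ (Fin 3)) := Metric.closedBall 0 (A * Real.sqrt (-t)) with hKdef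
    have hKc : IsCompact K := isCompact_closedBall _ _
    have hKne : K.Nonempty := ⟨0, Metric.mem_closedBall_self (by positivity)⟩
    set f : EuclideanSpace ℝ (Fin 3) → ℝ := fun y => Real.sqrt (-t) * |V t y 2| with hf
    have hfc : Continuous f := continuous_const.mul (continuous_abs.comp (hc2.comp (hV.contDiff_slice ht).continuous))
    obtain ⟨xs, hxsK, hmax⟩ := hKc.exists_isMaxOn hKne hfc.continuousOn
    have hxs_norm : ‖xs‖ ≤ A * Real.sqrt (-t) := mem_closedBall_zero_iff.1 hxsK
    refine ⟨xs, hxs_norm, le_antisymm (hdomV t ht xs) ?_⟩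
    by_contra hlt
    push Not at hlt
    set η : ℝ := (|v (-1) 0 2| - Real.sqrt (-t) * |V t xs 2|) / 3 with hη
    have hη0 : 0 < η := by
      have : 0 < |v (-1) 0 2| - Real.sqrt (-t) * |V t xs 2| := sub_pos.2 hlt
      rw [hη]; positivity
    obtain ⟨T, hT, hAPT⟩ := hAP η hη0
    -- uniform convergence of the blow-downs on the compact ball
    have hunif : TendstoUniformlyOn (fun j => w (φ j) t) (V t) atTop K :=
      (tendstoLocallyUniformlyOn_iff_tendstoUniformlyOn_of_compact hKc).1 (htlu t ht).tendstoLocallyUniformlyOn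
    have hev1 : ∀ᶠ j in atTop, ∀ y ∈ K, dist (V t y) (w (φ j) t y) < η / Real.sqrt (-t) :=
      Metric.tendstoUniformlyOn_iff.1 hunif _ (div_pos hη0 hst)
    -- eventually the physical time `c² t` is earlier than `T`
    have hcφ : Tendsto (fun j => c (φ j)) atTop atTop := hcTop.comp hφ.tendsto_atTop
    have hev2 : ∀ᶠ j in atTop, c (φ j) ^ 2 * t < T := by
      filter_upwards [hcφ.eventually_gt_atTop (Real.sqrt (T / t))] with j hj
      have hpos : 0 < T / t := div_pos_of_neg_of_neg hT ht
      have hs0 : 0 ≤ Real.sqrt (T / t) := Real.sqrt_nonneg _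
      have h2 : T / t < c (φ j) ^ 2 := by
        calc T / t = Real.sqrt (T / t) ^ 2 := (Real.sq_sqrt hpos.le).symm
          _ < c (φ j) ^ 2 := by nlinarith [hj, hs0]
      have h3 : c (φ j) ^ 2 * t < T := (div_lt_iff_of_neg ht).1 h2
      exact h3
    obtain ⟨j, hj1, hj2⟩ := (hev1.and hev2).exists
    have hcj : 0 < c (φ j) := hc0 _
    obtain ⟨x, hxA, hxpin⟩ := hAPT (c (φ j) ^ 2 * t) hj2
    have hsq : Real.sqrt (-(c (φ j) ^ 2 * t)) = c (φ j) * Real.sqrt (-t) :=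
      PoloidalWindowDoorPoloidalWindowRigidityEternalCoreScalingCore.sqrt_neg_sq_mul hcj.le
    set y : EuclideanSpace ℝ (Fin 3) := (c (φ j))⁻¹ • x with hy
    have hyK : y ∈ K := by
      rw [hKdef, mem_closedBall_zero_iff, hy, norm_smul, norm_inv, Real.norm_eq_abs, abs_of_pos hcj, inv_mul_le_iff₀ hcj]
      rw [hsq] at hxA
      calc ‖x‖ ≤ A * (c (φ j) * Real.sqrt (-t)) := hxA
        _ = c (φ j) * (A * Real.sqrt (-t)) := by ring
    have h3 : c (φ j) • y = x := by rw [hy, smul_smul, mul_inv_cancel₀ hcj.ne', one_smul]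
    have hwy : w (φ j) t y 2 = c (φ j) * v (c (φ j) ^ 2 * t) x 2 := by
      simp only [hw, nsRescale_apply, h3, PiLp.smul_apply, smul_eq_mul]
    have hwval : |v (-1) 0 2| - η < Real.sqrt (-t) * |w (φ j) t y 2| := by
      rw [hwy, abs_mul, abs_of_pos hcj, ← mul_assoc, mul_comm (Real.sqrt (-t)) (c (φ j)), ← hsq]
      exact hxpin
    -- pass to the limit profile through the uniform closeness on `K`
    have hd : dist (V t y) (w (φ j) t y) < η / Real.sqrt (-t) := hj1 y hyK
    have hcomp : |V t y 2 - w (φ j) t y 2| < η / Real.sqrt (-t) := (abs_apply_two_sub_le_dist _ _).trans_lt hd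
    have h2 : Real.sqrt (-t) * |V t y 2 - w (φ j) t y 2| < η := by
      have h := mul_lt_mul_of_pos_left hcomp hst
      have e : Real.sqrt (-t) * (η / Real.sqrt (-t)) = η := by field_simp
      rwa [e] at h
    have h1 : |w (φ j) t y 2| ≤ |V t y 2| + |V t y 2 - w (φ j) t y 2| := by
      have := abs_sub_abs_le_abs_sub (w (φ j) t y 2) (V t y 2)
      rw [abs_sub_comm] at this
      linarith
    have hVy : |v (-1) 0 2| - 2 * η < f y := by
      have h4 : Real.sqrt (-t) * |w (φ j) t y 2| ≤ Real.sqrt (-t) * |V t y 2| + Real.sqrt (-t) * |V t y 2 - w (φ j) t y 2| := by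
        have := mul_le_mul_of_nonneg_left h1 hst.le
        rwa [mul_add] at this
      show |v (-1) 0 2| - 2 * η < Real.sqrt (-t) * |V t y 2|
      linarith
    have hfy : f y ≤ f xs := hmax hyK
    have hfxs : f xs = |v (-1) 0 2| - 3 * η := by
      show Real.sqrt (-t) * |V t xs 2| = |v (-1) 0 2| - 3 * ((|v (-1) 0 2| - Real.sqrt (-t) * |V t xs 2|) / 3)
      ring
    linarith
  -- re-centre at the time-(−1) full-pin point `y₀`, `‖y₀‖ ≤ A`
  obtain ⟨y₀, hy₀A, hy₀val⟩ := hkey (-1) (by norm_num)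
  have hs1 : Real.sqrt (-(-1 : ℝ)) = 1 := by norm_num
  rw [hs1, mul_one] at hy₀A
  rw [hs1, one_mul] at hy₀val
  have hy₀val' : Real.sqrt (-(-1 : ℝ)) * |V (-1) y₀ 2| = |v (-1) 0 2| := by rw [hs1, one_mul]; exact hy₀val
  obtain ⟨hPW1, habs1⟩ := pinned_recentre hV hpolV hdomV hm0 (by norm_num : (-1 : ℝ) < 0) hy₀val'
  set W : ℝ → EuclideanSpace ℝ (Fin 3) → EuclideanSpace ℝ (Fin 3) := fun s y => V s (y₀ + y) with hWdef
  have hWeq : nsRescale (Real.sqrt (-(-1 : ℝ))) (fun s y => V s (y₀ + y)) = W := by rw [hs1, nsRescale_one]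
  rw [hWeq] at hPW1 habs1
  have hKW1 : Peakless W := by
    have h := peakless_recentre hKV (by norm_num : (0 : ℝ) < 1) y₀
    rwa [nsRescale_one] at h
  refine ⟨W, hPW1, hKW1, habs1, fun t ht => ?_⟩
  -- eternal pins with aperture `2A`
  have ht0 : t < 0 := by linarith
  obtain ⟨xs, hxsA, hxsval⟩ := hkey t ht0
  have hst1 : 1 ≤ Real.sqrt (-t) := by
    rw [show (1 : ℝ) = Real.sqrt 1 from Real.sqrt_one.symm]
    exact Real.sqrt_le_sqrt (by linarith)
  refine ⟨xs - y₀, ?_, ?_, ?_⟩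
  · calc ‖xs - y₀‖ ≤ ‖xs‖ + ‖y₀‖ := norm_sub_le _ _
      _ ≤ A * Real.sqrt (-t) + A := add_le_add hxsA hy₀A
      _ ≤ 2 * A * Real.sqrt (-t) := by nlinarith [hA, hst1]
  · have e : W t (xs - y₀) = V t xs := by simp only [hWdef, add_sub_cancel]
    rw [e, habs1]; exact hxsval
  · have hpolW : ∀ s < 0, ∀ y, ⟪curl (W s) y, EuclideanSpace.single 2 1⟫_ℝ = 0 :=
      PoloidalWindowDoorPoloidalWindowRigidityPoloidalExtremal.poloidal_translate hpolV y₀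
    have hdomW : ∀ s < 0, ∀ y, Real.sqrt (-s) * |W s y 2| ≤ |v (-1) 0 2| := fun s hs y => hdomV s hs (y₀ + y)
    have hvalW : Real.sqrt (-t) * |W t (xs - y₀) 2| = |v (-1) 0 2| := by
      have e : W t (xs - y₀) = V t xs := by simp only [hWdef, add_sub_cancel]
      rw [e]; exact hxsval
    exact (pinned_recentre (isTypeIAncientMild_translate hV y₀) hpolW hdomW hm0 ht0 hvalW).1

/-- **The eternal hot web (PROVED from the tree's `hotSpot_component_unbounded`, K2-p3 (Q0)):** at every past time of an eternally pinned PEAKLESS profile, the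
planar hot component of the re-centred blow-down through its hot point is UNBOUNDED — the hot spot is, at every time, a point of an unbounded closed planar
set on which the scale-invariant vertical speed equals the pin. -/
theorem eternalWeb_unbounded {A C : ℝ} {v : ℝ → EuclideanSpace ℝ (Fin 3) → EuclideanSpace ℝ (Fin 3)} (hK : Peakless v) (hE : EternallyPinned A C v) :
    ∀ t : ℝ, t ≤ -1 → ∃ x : EuclideanSpace ℝ (Fin 3), ‖x‖ ≤ A * Real.sqrt (-t) ∧ Real.sqrt (-t) * |v t x 2| = |v (-1) 0 2| ∧
      ¬ Bornology.IsBounded (connectedComponentIn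
        {y : EuclideanSpace ℝ (Fin 3) | y 2 = 0 ∧ nsRescale (Real.sqrt (-t)) (fun s y => v s (x + y)) (-1) y 2 =
          nsRescale (Real.sqrt (-t)) (fun s y => v s (x + y)) (-1) 0 2} 0) := by
  intro t ht
  obtain ⟨x, hxA, hval, hPU⟩ := hE t ht
  have hc0 : 0 < Real.sqrt (-t) := Real.sqrt_pos.2 (by linarith)
  exact ⟨x, hxA, hval, PoloidalWindowDoorPoloidalWindowRigidityHotSplitRidgeKernels.hotSpot_component_unbounded hPU (peakless_recentre hK hc0 x)⟩

/-! ## §18 Hand U4b — the VERTICAL CORE (quantitative unique continuation along the poloidal axis; PROVABLE, M) and the floor it gives the breathing branch -/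

/-- **U4b `VerticalCore` (PROVABLE, M — hand target).**  For every Type-I constant `C`, speed threshold `ε₀ > 0` and aperture `A > 0` there is `δ = δ(C, ε₀, A) > 0`
such that every class-`C` e₂-poloidal profile with scale-invariant speed `√(−r)‖U(r,y)‖ ≥ ε₀` at a point `(r, y)` has, AT THE SAME TIME and within
`‖x − y‖ ≤ A√(−r)`, scale-invariant VERTICAL speed `√(−r)|U₂(r,x)| ≥ δ`.  Proof for the hand (template: U3a `…LeastPinAnisotropicGap.anisotropicGap`, p709185, the
same extraction): a violating sequence `Uₙ, (rₙ, yₙ)` with `√(−rₙ)|Uₙ,₂(rₙ, ·)| ≤ 1/(n+1)` on the ball `‖x − yₙ‖ ≤ A√(−rₙ)`; renormalise `(rₙ, yₙ) ↦ (−1, 0)` by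
`nsRescale √(−rₙ) (Uₙ(·, yₙ + ·))` (class `C`: `isTypeIAncientMild_nsRescale ∘ isTypeIAncientMild_translate`; poloidal: `poloidal_nsRescale ∘ poloidal_translate`);
a KNSS limit with gradients (`exists_tendsto_of_isTypeIAncientMild_seq`, `poloidal_of_tendsto`) is class `C`, poloidal at time `−1`, has `‖V(−1,0)‖ ≥ ε₀` and
`V₂(−1,·) ≡ 0` on the open ball `‖x‖ < A` — hence `∂₀V₂(−1,·) = 0` there, so `V ≡ 0` by the tree's
`…SymmetryGerms.eq_zero_of_horizontalGradient_eq_zero_on_open` (an `L^∞` conjugate-harmonic pair argument + analyticity): contradiction. -/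
def VerticalCore : Prop :=
  ∀ C ε₀ A : ℝ, 0 < ε₀ → 0 < A → ∃ δ : ℝ, 0 < δ ∧
    ∀ U : ℝ → EuclideanSpace ℝ (Fin 3) → EuclideanSpace ℝ (Fin 3), IsTypeIAncientMild C U →
      (∀ s < 0, ∀ y, ⟪curl (U s) y, EuclideanSpace.single 2 1⟫_ℝ = 0) →
      ∀ r : ℝ, r < 0 → ∀ y : EuclideanSpace ℝ (Fin 3), ε₀ ≤ Real.sqrt (-r) * ‖U r y‖ →
        ∃ x : EuclideanSpace ℝ (Fin 3), ‖x - y‖ ≤ A * Real.sqrt (-r) ∧ δ ≤ Real.sqrt (-r) * |U r x 2|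

/-- components of the derivative: `D(wᵢ)(x)u = (Dw(x)u)ᵢ` (folklore; as in the tree's `CriticalFluxDoorPressureIBP.fderiv_coord_apply`). -/
theorem fderiv_coord_apply_two {w : EuclideanSpace ℝ (Fin 3) → EuclideanSpace ℝ (Fin 3)} {x : EuclideanSpace ℝ (Fin 3)}
    (hw : DifferentiableAt ℝ w x) (i : Fin 3) (u : EuclideanSpace ℝ (Fin 3)) :
    fderiv ℝ (fun y => w y i) x u = (fderiv ℝ w x u) i := by
  have h := ((EuclideanSpace.proj i : EuclideanSpace ℝ (Fin 3) →L[ℝ] ℝ).hasFDerivAt.comp x hw.hasFDerivAt)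
  rw [show (fun y => w y i) = (EuclideanSpace.proj i : EuclideanSpace ℝ (Fin 3) →L[ℝ] ℝ) ∘ w from rfl, h.fderiv]
  rfl

/-- **U4b `VerticalCore` — PROVED (the hand is closed in-file; ≈ 90 lines).**  Compactness-and-contradiction exactly as announced in the docstring of `VerticalCore`:
a violating sequence is renormalised to `(r, y) = (−1, 0)` by `nsRescale √(−rₙ) (Uₙ(·, yₙ + ·))`, a KNSS limit (`exists_tendsto_of_isTypeIAncientMild_seq`) is
class `C`, e₂-poloidal (`poloidal_of_tendsto`), has `‖W(−1,0)‖ ≥ ε₀` and `W₂(−1,·) ≡ 0` on the open ball `‖z‖ < A`, hence `∂₀W₂(−1,·) = 0` there and `W ≡ 0` by the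
tree's `…SymmetryGerms.eq_zero_of_horizontalGradient_eq_zero_on_open` — contradiction. -/
theorem verticalCore_holds : VerticalCore := by
  intro C ε₀ A hε₀ hA
  by_contra hcon
  push Not at hcon
  choose U hU hpol r hr y hy hcold using fun k : ℕ => hcon (1 / ((k : ℝ) + 1)) (by positivity)
  -- renormalise `(r k, y k) ↦ (−1, 0)`
  set c : ℕ → ℝ := fun k => Real.sqrt (-(r k)) with hc
  have hc0 : ∀ k, 0 < c k := fun k => Real.sqrt_pos.2 (by linarith [hr k])
  have hcsq : ∀ k, c k ^ 2 = -(r k) := fun k => Real.sq_sqrt (by linarith [hr k])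
  set V : ℕ → ℝ → EuclideanSpace ℝ (Fin 3) → EuclideanSpace ℝ (Fin 3) := fun k => nsRescale (c k) (fun s z => U k s (y k + z)) with hV
  have hVc : ∀ k, IsTypeIAncientMild C (V k) := fun k => (isTypeIAncientMild_translate (hU k) (y k)).nsRescale (hc0 k)
  have hpolV : ∀ k, ∀ s < 0, ∀ z, ⟪curl (V k s) z, EuclideanSpace.single 2 1⟫_ℝ = 0 := fun k =>
    PoloidalWindowDoorPoloidalWindowRigidityPoloidalExtremal.poloidal_nsRescale
      (PoloidalWindowDoorPoloidalWindowRigidityPoloidalExtremal.poloidal_translate (hpol k) (y k)) (hc0 k)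
  have htime : ∀ k, c k ^ 2 * (-1 : ℝ) = r k := fun k => by rw [hcsq k]; ring
  -- speed `≥ ε₀` at `(−1, 0)`
  have hval : ∀ k, ε₀ ≤ ‖V k (-1) 0‖ := fun k => by
    have e : V k (-1) 0 = c k • U k (r k) (y k) := by
      simp only [hV, nsRescale_apply, smul_zero, add_zero, htime k]
    rw [e, norm_smul, Real.norm_eq_abs, abs_of_pos (hc0 k)]
    exact hy k
  -- cold ball: `|V k (−1) z 2| < 1/(k+1)` for `‖z‖ ≤ A`
  have hcoldV : ∀ k, ∀ z : EuclideanSpace ℝ (Fin 3), ‖z‖ ≤ A → |V k (-1) z 2| < 1 / ((k : ℝ) + 1) := fun k z hz => by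
    have e : V k (-1) z = c k • U k (r k) (y k + c k • z) := by
      simp only [hV, nsRescale_apply, htime k]
    have hx : ‖(y k + c k • z) - y k‖ ≤ A * Real.sqrt (-(r k)) := by
      rw [add_sub_cancel_left, norm_smul, Real.norm_eq_abs, abs_of_pos (hc0 k)]
      calc c k * ‖z‖ ≤ c k * A := mul_le_mul_of_nonneg_left hz (hc0 k).le
        _ = A * Real.sqrt (-(r k)) := by rw [hc]; ring
    have h := hcold k (y k + c k • z) hx
    rw [e, PiLp.smul_apply, smul_eq_mul, abs_mul, abs_of_pos (hc0 k)]
    exact h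
  -- KNSS limit
  obtain ⟨φ, hφ, W, hW, hpt, hfd, htlu, -⟩ := exists_tendsto_of_isTypeIAncientMild_seq C hVc
  have hpolW : ∀ s < 0, ∀ z, ⟪curl (W s) z, EuclideanSpace.single 2 1⟫_ℝ = 0 :=
    fun s hs z => PoloidalWindowDoorPoloidalWindowRigidityPoloidalExtremal.poloidal_of_tendsto (hfd s hs z) (fun j => hpolV (φ j) s hs z)
  have h10 : (-1 : ℝ) < 0 := by norm_num
  -- `‖W(−1,0)‖ ≥ ε₀`
  have hW0 : ε₀ ≤ ‖W (-1) 0‖ :=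
    ge_of_tendsto ((continuous_norm.tendsto _).comp (hpt (-1) h10 0)) (Eventually.of_forall fun j => hval (φ j))
  -- `W₂(−1,·) ≡ 0` on the open ball of radius `A`
  have hc2 : Continuous fun a : EuclideanSpace ℝ (Fin 3) => |a 2| := continuous_abs.comp (by fun_prop)
  have hWz : ∀ z : EuclideanSpace ℝ (Fin 3), ‖z‖ < A → W (-1) z 2 = 0 := fun z hz => by
    have hlim : Tendsto (fun j => |V (φ j) (-1) z 2|) atTop (𝓝 |W (-1) z 2|) := (hc2.tendsto _).comp (hpt (-1) h10 z)
    have hφr : Tendsto (fun j => 1 / (((φ j : ℕ) : ℝ) + 1)) atTop (𝓝 0) :=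
      tendsto_one_div_add_atTop_nhds_zero_nat.comp hφ.tendsto_atTop
    have hzero : Tendsto (fun j => |V (φ j) (-1) z 2|) atTop (𝓝 0) :=
      squeeze_zero (fun j => abs_nonneg _) (fun j => (hcoldV (φ j) z hz.le).le) hφr
    exact abs_eq_zero.1 (tendsto_nhds_unique hlim hzero)
  -- hence `∂₀ W₂(−1,·) = 0` on the ball
  have hWdiff : ∀ z, DifferentiableAt ℝ (W (-1)) z := fun z =>
    (((hW.contDiff_slice h10).differentiable (by simp)).differentiableAt)
  have hgrad : ∀ z ∈ Metric.ball (0 : EuclideanSpace ℝ (Fin 3)) A, fderiv ℝ (W (-1)) z (EuclideanSpace.single 0 1) 2 = 0 := by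
    intro z hz
    have hΦ : (fun z' => W (-1) z' 2) =ᶠ[𝓝 z] fun _ => (0 : ℝ) := by
      filter_upwards [Metric.isOpen_ball.mem_nhds hz] with z' hz'
      exact hWz z' (mem_ball_zero_iff.1 hz')
    have h1 : fderiv ℝ (fun z' => W (-1) z' 2) z = 0 := by
      rw [hΦ.fderiv_eq]; simp
    have h2 := fderiv_coord_apply_two (hWdiff z) 2 (EuclideanSpace.single 0 1)
    rw [h1] at h2
    simpa using h2.symm
  have hzeroW : ∀ t < 0, ∀ x, W t x = 0 :=
    PoloidalWindowDoorPoloidalWindowRigiditySymmetryGerms.eq_zero_of_horizontalGradient_eq_zero_on_open hW.hasTypeITimeDecay hW.continuousOn_uncurry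
      (fun s t hst ht x => hW.mild_eq_heatExtension hst ht x) (fun t ht => hW.isDivFree ht) h10 (hpolW (-1) h10) Metric.isOpen_ball
      ⟨0, Metric.mem_ball_self hA⟩ hgrad
  have : ‖W (-1) 0‖ = 0 := by rw [hzeroW (-1) h10 0, norm_zero]
  linarith

/-- **U4b `VerticalCore`** under its LINE 26 name (kept so that every downstream kernel is unchanged; NO LONGER a `sorry`). -/
theorem stub_verticalCore : VerticalCore := verticalCore_holds

/-- **The VERTICAL ETERNAL CORE (PROVED from U2b's eternal core and U4b):** the paraboloid pin value of a pinned profile has a POSITIVE FLOOR in every backward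
scale window — for some `δ, R > 0`, every window `[4t₀, t₀]`, `t₀ < −1`, contains a time `r` and a point `‖x‖ ≤ R√(−r)` with `√(−r)|U₂(r,x)| ≥ δ`.  (So in the
breathing branch `M_R` oscillates for ever between `≤ |N| − η(R)` and `≥ δ`, while `M_{Λ(η′)}` returns above `|N| − η′`: LINE 25.) -/
theorem verticalEternalCore_of_pinned (hG : ParaboloidGap) (hVC : VerticalCore) {C : ℝ} {U : ℝ → EuclideanSpace ℝ (Fin 3) → EuclideanSpace ℝ (Fin 3)}
    (hP : Pinned C U) :
    ∃ δ : ℝ, 0 < δ ∧ ∃ R : ℝ, 0 < R ∧ ∀ t₀ : ℝ, t₀ < -1 → ∃ r ∈ Set.Icc (4 * t₀) t₀, ∃ x : EuclideanSpace ℝ (Fin 3),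
      ‖x‖ ≤ R * Real.sqrt (-r) ∧ δ ≤ Real.sqrt (-r) * |U r x 2| := by
  obtain ⟨ε₀, hε₀, R₀, hR₀, hcore⟩ := eternalCore_of_pinned hG hP
  obtain ⟨δ, hδ, hvc⟩ := hVC C ε₀ 1 hε₀ one_pos
  refine ⟨δ, hδ, R₀ + 1, by linarith, fun t₀ ht₀ => ?_⟩
  obtain ⟨r, hr, y, hy, hspeed⟩ := hcore t₀ ht₀
  have hr0 : r < 0 := by linarith [hr.2]
  obtain ⟨x, hxy, hval⟩ := hvc U (class_of_pinned hP) hP.2.2.2.2.1 r hr0 y hspeed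
  refine ⟨r, hr, x, ?_, hval⟩
  calc ‖x‖ = ‖(x - y) + y‖ := by rw [sub_add_cancel]
    _ ≤ ‖x - y‖ + ‖y‖ := norm_add_le _ _
    _ ≤ 1 * Real.sqrt (-r) + R₀ * Real.sqrt (-r) := add_le_add hxy hy
    _ = (R₀ + 1) * Real.sqrt (-r) := by ring

/-! ## §19 The two research cells of LINE 26 (OPEN): ETERNAL-WEB and BREATHING — together they ARE the cell ETERNAL-PIN of LINE 25 (kernel §20) -/

/-- **Research cell ETERNAL-WEB (OPEN).**  Kill a least-pin critical element (all of LINE 25's binders) which is ETERNALLY PINNED with bounded aperture: at every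
past time `t ≤ −1` the full pin `|N|` is realised at a point `‖x(t)‖ ≤ A√(−t)` and the re-centred blow-down there is again a pinned profile of the column —
hence (PROVED data, `eternalWeb_unbounded`) carries an unbounded planar hot web through its hot point, all pins, the pressure push `σ∂₂p ≤ −|N|/(2(−t)^{3/2})`
(tree `threadTimePin` algebra), at EVERY time.  This is the typed object of the (TH) column's candidate (M2) «is (G3) saturated at ALL times?» (LEAD K2-p3 g14,
T2B-g14.md §14b) — in the THICK column, and with the saturation DERIVED from a dichotomy rather than assumed.  Natural enemies: the self-similar profiles (dead:
tree `…RotDriftLiouville`, Tsai) and an exactly-pinned poloidal DSS profile (sits inside `Literature.Barriers.NavierStokesRegularity.NearOneDssTypeIExclusion`'s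
open sector: λ arbitrary, no spatial decay). -/
def CellEternalWeb : Prop :=
  AnisotropicGap →
  ∀ (C A : ℝ) (v : ℝ → EuclideanSpace ℝ (Fin 3) → EuclideanSpace ℝ (Fin 3)) (W : Set (ℝ × EuclideanSpace ℝ (Fin 3))),
    Pinned C v → ThickWindow v W → Peakless v → LeastPin C v → NoPinLoss C v → PastPin C v → ScaleWindowPin v →
    0 < A → EternallyPinned A C v → False

/-- **stub — research cell ETERNAL-WEB** (OPEN; a `sorry` of the file). -/
theorem stub_cellEternalWeb : CellEternalWeb := by
  sorry

/-- **Research cell BREATHING (OPEN).**  Kill a least-pin critical element (all of LINE 25's binders) which BREATHES in every paraboloid: for every aperture `A`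
a definite dip `η(A) > 0` of the paraboloid pin value recurs at arbitrarily ancient times, while (LINE 25) `M_{Λ(η′)}` returns above `|N| − η′` in every scale
window and (U4b, `verticalEternalCore_of_pinned`) `M_R ≥ δ > 0` in every scale window — an ever-oscillating pin value with a floor.  Natural enemy: a generic
e₂-poloidal Type-I DSS profile (log-periodic breathing).  `VerticalCore` (hand U4b) is given as data. -/
def CellBreathing : Prop :=
  AnisotropicGap → VerticalCore →
  ∀ (C : ℝ) (v : ℝ → EuclideanSpace ℝ (Fin 3) → EuclideanSpace ℝ (Fin 3)) (W : Set (ℝ × EuclideanSpace ℝ (Fin 3))),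
    Pinned C v → ThickWindow v W → Peakless v → LeastPin C v → NoPinLoss C v → PastPin C v → ScaleWindowPin v →
    Breathing v → False

/-- **stub — research cell BREATHING** (OPEN; a `sorry` of the file). -/
theorem stub_cellBreathing : CellBreathing := by
  sorry

/-! ## §20 Kernel (checked, no sorry): cell ETERNAL-PIN ⇐ THGerm ∧ U4b ∧ ETERNAL-WEB ∧ BREATHING -/

/-- **KERNEL (PROVED).**  LINE 25's cell ETERNAL-PIN follows from the two cells of LINE 26 (given `THGerm` for the thick window of the extracted profile and
`VerticalCore` as the breathing cell's datum): by `dichotomy`, a least-pin profile either breathes — cell BREATHING — or is asymptotically pinned in some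
paraboloid; then `eternalWebExtraction` produces a pinned, peakless, ETERNALLY PINNED profile `W'` WITH THE SAME PIN VALUE, which is therefore again LEAST-PIN,
obeys NO-PIN-LOSS (U3b by name), PAST PIN and the SCALE-WINDOW PIN (LINE 25's theorems), and is thick at its pin mod S0 (`thickWindow_of_dense`) — cell
ETERNAL-WEB kills it. -/
theorem cellEternalPin_of_cells (hTH : THGerm) (hVC : VerticalCore) (hweb : CellEternalWeb) (hbr : CellBreathing) : CellEternalPin := by
  intro hAG C v W hP hW hK hL hNPL hPP hSWP
  rcases dichotomy v with ⟨A, hA, hAP⟩ | hB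
  · obtain ⟨W', hPW', hKW', habs, hEP⟩ := eternalWebExtraction hP hK hA hAP
    have hLW' : LeastPin C W' := fun v'' hP'' hK'' => habs ▸ hL v'' hP'' hK''
    have hNPLW' : NoPinLoss C W' := stub_noPinLoss hAG C W' hPW' hKW' hLW'
    have hPPW' : PastPin C W' := fun V hV hpol hKV hdom hnz => pastPin hPW'.2.2.2.2.2.1 hNPLW' hV hpol hKV hdom hnz
    have hSWPW' : ScaleWindowPin W' := scaleWindowPin_of_noPinLoss hPW' hKW' hNPLW'
    obtain ⟨W'', hW''⟩ := thickWindow_of_dense thickDense_holds hTH hPW'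
    exact hweb hAG C (2 * A) W' W'' hPW' hW'' hKW' hLW' hNPLW' hPPW' hSWPW' (by linarith) hEP
  · exact hbr hAG hVC C v W hP hW hK hL hNPL hPP hSWP hB

/-- With the hand U4b taken from its stub. -/
theorem cellEternalPin_of_cellsStub (hTH : THGerm) (hweb : CellEternalWeb) (hbr : CellBreathing) : CellEternalPin :=
  cellEternalPin_of_cells hTH stub_verticalCore hweb hbr

/-! ## §21 Compositions to the crux items BY NAME (CONDITIONAL on S0, the wall ⟨27893⟩, the hand U4b and the two cells; no summit, no crux is proved) -/

/-- **The crux `PoloidalWindowRigidity` (K2, stmt-NavierStokesRegularity-19708) BY NAME ⇐ S0 ∧ ⟨27893⟩ ∧ U4b ∧ ETERNAL-WEB ∧ BREATHING.**  CONDITIONAL. -/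
theorem PoloidalWindowRigidity_of_cells (hS0 : S0Statement)
    (hG : Summit.NavierStokesRegularity.NavierStokesRegularity.Theses.LoopPeriodRatchet.FrequencyGrowthExponent)
    (hVC : VerticalCore) (hweb : CellEternalWeb) (hbr : CellBreathing) :
    Summit.NavierStokesRegularity.NavierStokesRegularity.Theses.PoloidalWindowDoor.PoloidalWindowRigidity :=
  PoloidalWindowRigidity_of_eternalPin hS0 hG (cellEternalPin_of_cells (thGerm_of_S0 hS0) hVC hweb hbr)

/-- **The item `LrcModEntire` (stmt-NavierStokesRegularity-20428) BY NAME ⇐ S0 ∧ ⟨27893⟩ ∧ U4b ∧ ETERNAL-WEB ∧ BREATHING.**  CONDITIONAL. -/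
theorem LrcModEntire_of_cells (hS0 : S0Statement)
    (hG : Summit.NavierStokesRegularity.NavierStokesRegularity.Theses.LoopPeriodRatchet.FrequencyGrowthExponent)
    (hVC : VerticalCore) (hweb : CellEternalWeb) (hbr : CellBreathing) :
    Summit.NavierStokesRegularity.NavierStokesRegularity.Theses.PoloidalWindowDoor.LrcModEntire :=
  LrcModEntire_of_eternalPin hS0 hG (cellEternalPin_of_cells (thGerm_of_S0 hS0) hVC hweb hbr)

/-- With the two research cells taken from their stubs — the shape the lead consumes (v1.2 doc: the ONLY sorries behind this theorem are the two research cells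
`stub_cellEternalWeb`, `stub_cellBreathing`; the hand U4b `stub_verticalCore` is PROVED, `verticalCore_holds`). -/
theorem PoloidalWindowRigidity_of_cellStubs (hS0 : S0Statement)
    (hG : Summit.NavierStokesRegularity.NavierStokesRegularity.Theses.LoopPeriodRatchet.FrequencyGrowthExponent) :
    Summit.NavierStokesRegularity.NavierStokesRegularity.Theses.PoloidalWindowDoor.PoloidalWindowRigidity :=
  PoloidalWindowRigidity_of_cells hS0 hG stub_verticalCore stub_cellEternalWeb stub_cellBreathing

theorem LrcModEntire_of_cellStubs (hS0 : S0Statement)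
    (hG : Summit.NavierStokesRegularity.NavierStokesRegularity.Theses.LoopPeriodRatchet.FrequencyGrowthExponent) :
    Summit.NavierStokesRegularity.NavierStokesRegularity.Theses.PoloidalWindowDoor.LrcModEntire :=
  LrcModEntire_of_cells hS0 hG stub_verticalCore stub_cellEternalWeb stub_cellBreathing

end Summit.NavierStokesRegularity.NavierStokesRegularity.Cruxes.PoloidalWindowRigidity.EternalWeb
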